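import Mathlib
import HarnessLib
import HarnessLib.Audit
import Summits.ResolutionOfSingularities.Statement
import Summits.ResolutionOfSingularities.ResolutionOfSingularities.Theorems.RadicandSplitCorank
import Literature.Barriers.ResolutionOfSingularities.DimensionFourFrontier
import Literature.AlgebraicGeometry.Resolution.LogRegularScheme
import Summits.ResolutionOfSingularities.ResolutionOfSingularities.Theorems.GaloisWebClasses
import Summits.ResolutionOfSingularities.ResolutionOfSingularities.Theorems.MaxOrderAtomClasses
import HarnessLib.Audit.Status.Attr

/-!
Route: Dominance

# Route Dominance — resolution splits exactly into regular roofs (models) and resolution of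
sandwiched schemes (dominance)

It suffices to show X = RegularRoofs ∧ SandwichedResolve, and X is EXACTLY the summit (kernel
`summit_iff` in the
draft Dominance.lean). RegularRoofs (RR, the MODEL axis): every integral separated finite-type X
over a field k of
characteristic p has a regular roof X ←a− Γ −b→ Y (a proper birational, Γ reduced, b separated
finite-type
birational, Y regular separated finite type) — up to Nagata compactification and the closed-graph
construction the
classical «every finitely generated K/k has a regular proper model». SandwichedResolve (MR, the
DOMINATION axis):
every reduced Γ with a separated finite-type birational morphism onto a regular Y has a resolution —
dominance
WITHOUT principalization, the bottom of the tree's sandwiched family (SANDᴸ ⇒ SANDʷ ⇒ MR at V = ⊤,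
kernel).
Root node of the decomposition cell decomp-res, lens 4 «normal forms N = sandwiched schemes;
reduction = regular
roof»; no descent residual (both pieces quantify over every field).
Lean: `Summit.ResolutionOfSingularities.ResolutionOfSingularities.Theses.Dominance.RegularRoofs ∧
Summit.ResolutionOfSingularities.ResolutionOfSingularities.Theses.Dominance.SandwichedResolve`

## Assembly
Pure logic over two tree theorems: reduce to integral X
(`ComponentGluing.resolutionInChar_iff_integral`), take a
regular roof X ← Γ → Y from RegularRoofs, resolve the sandwiched Γ by SandwichedResolve, compose
with the proper
birational a (`ComponentGluing.Scheme.HasResolution.of_isBirational`). Deciding theorem `closes` in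
glue.lean (8 lines)
uses both cruxes; the draft also proves the converse (`summit_iff`).

Rationale: WHY THIS LINE. Zariski–Abhyankar–Cutkosky prove resolution of threefolds in two logically distinct
moves: produce a nonsingular projective MODEL of the function field (local uniformization + patching
on the Zariski–Riemann space; Cutkosky2009 Thm 10.1, Step 4, p. 2) and then DOMINATE the given
variety from it (closed graph Γ ⊂ V × W is a blow-up of an ideal on the regular W, principalize it:
Cutkosky2009 p. 37, Hartshorne1977 II.7.17); Cutkosky names the extension of principalization (Thms
1.2/1.3) and of patching as «the major obstacle» in higher dimension (p. 3). This line types the two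
moves as two statements whose conjunction is kernel-equivalent to the root, with the domination half
weakened from principalization (census C2, harder than the summit) to mere resolvability of
SANDWICHED schemes — a class with its own mechanisms in print (Spivakovsky1990; CossartPiltant2019
in dim ≤ 3) and a SCOPE CERTIFICATE: cones over non-ruled smooth projective varieties admit no
birational morphism to a regular scheme (Abhyankar1956Valuations Prop. 3–4, arXiv:math/0207171 Ex.
2.5) yet are resolved by one blow-up, so S is known on a family disjoint from MR's scope in every
dimension. NEAREST IN-TREE ART (census v2 anchor A7; tribunal note n1): Zariski's bisection is
already KERNEL in ProperModel language,
`Literature.AlgebraicGeometry.Resolution.ProperModel.resolutionInChar_iff_twoModelPatching_and_regModel`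
(Literature/AlgebraicGeometry/Resolution/ProperModelsRegModel.lean:140): ResolutionInChar p ⟺
TwoModelPatching p ∧ RegModel p. DELTA: this route is A7's sibling typing with (i) the models half
in ROOF form over every integral separated finite-type X (RegularRoofs; non-proper X and Y allowed,
`closes` Nagata-free; RegModel + Nagata + graph closure ⇒ RR for proper X, RR ⇒ RegModel for fields
with a proper model) and (ii) the patching half WEAKENED from two-model patching to plain
resolvability of ONE sandwiched Γ → Y regular (SandwichedResolve); MR(proper) ⟸ SANDʷ at V = ⊤ ⟸
TwoModelPatching, and the ORDER CERTIFICATE is now a tree theorem: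
`Summit.ResolutionOfSingularities.ResolutionOfSingularities.Theorems.DominanceOfTwoModelPatching.sandwichedResolve_of_twoModelPatching
: NagataCompactification.{0} → (∀ p, p.Prime → ProperModel.TwoModelPatching.{0} p) →
SandwichedResolve` (p758136, commit b227845bf5eb; lens-4 g2 AffineCore) — so MR ≤ E2 ≤ S by name
(with tree `ProperModel.twoModelPatching_of_resolutionInChar`), converse unknown; the Dominance and
A7 decompositions are NESTED, 24572 the finer residual. WHY THIS IS NOVEL: no paper and no other
route in the tree states S ⟺ RegularRoofs ∧ SandwichedResolve — Zariski's model-versus-domination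
bisection typed exactly, valuation-free on the model side and principalization-free on the
domination side — nor the Abhyankar-ruledness scope certificate (searches under NOVELTY; tribunal
T2: sibling of A7, no MERGE-INTO among the sub-problem's Theses). WORKSHOP RECORD (cell decomp-res,
D-0178/D-0179 residual mode; route-writer decomp-res-writer-1; opened by decomp-res-lens-4
2026-08-30T01:52:17Z from HOME/decomp-res-lens-4/Dominance.lean sha256 138057f0… — kernels
summit_iff, regularRoofs_of_summit, sandwichedResolve_of_summit, roof_of_sandwiched,
sandwichedResolveDimLE_three, …_of_summit of the five asides; BC7 2/2 CLEAN — and ADOPTED by the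
writer as the cell's generation-0 ROOT node, no second file). CRITIC decomp-res-crit-1 CLEARED
2026-08-30T01:53:37Z (HOME/CRITIC-LEDGER.md row 6) with ERRATUM 02:58:05Z (row after 12). TRIBUNAL
census-trib-res-1 2026-08-30T02:36Z: SPLIT-WITH-RESIDUAL, slim pass, ledger summit-live-provisional
(run/shared/lean/pub/route-census/trib/TRIB-RES-DECOMP.md + .tsv; exactness root_iff_pieces,
all_items_of_summit ×8 and assembly_holds re-derived against the TREE decls, axioms standard).
PER-PIECE TAGS (critic + tribunal, erratum applied): RegularRoofs 24573 = the ATTACKED conjunct —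
NECESSARY ✓ · WEAKER(evidence: CERTIFIED by a separating CLASS: RR is a theorem on every sandwiched
X (kernel roof_of_sandwiched) and on every X whose function field has a regular proper model — all
rational X, every pencil graph {u·g = h}, Bl_I 𝔸⁴ — a class on which S is OPEN from dimension 4; RR
is not cheap: for proper X, RR ⇒ LU_abs(K(X))) · junk-free · leaf IDEA-NEEDED; census T-RR-bed
(HOME/census/T-RR-bed.md): on the wild dim ≥ 4 bed RR is VACUOUS 35 / SETTLED 13 / OPEN 11
(radicial-extension fields), T-RR-rho (T-RR-rho.md a2eac5b2…): by torus splitting the models half is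
vacuous-or-settled on 113/113 held germs (instrument-less on every held bed; MODELS-BED-v0 M1–M5 are
the first candidate fields), T-RR-stab (kit j338244, T-RR-stab.md 428b1fa9…). SandwichedResolve
24572 = DECLARED RESIDUAL — NECESSARY ✓ · UNDECIDED(costume-risk) booked, after the critic's
ERRATUM, as «UNDECIDED both ways; FUNCTORIALLY summit-equivalent two dimensions down by the
𝔾_m-fixed-locus certificate (every functorial/equivariant proof of MR_m resolves all
(m−2)-dimensional hypersurfaces); bare transfer open both ways» — the earlier reading «S shifted one
dimension down by the suspension Q_(h,N) = {u·x₁^N = h}» (used in the tribunal text) is WITHDRAWN as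
not established (Frobenius-twisted cylinder, no descent to Cartier slices in char p), while MR ⊇
Q_(h,N) stands; tribunal: summit-strength in substance yet NOT costume by implication (MR ⟹ S
unknown; absorption = RR open; no separating class can exist inside MR's scope) ⇒ residual-axis
score 0, NEXT DECOMPOSITION TARGET · leaf IDEA-NEEDED; census T-MR-spec (T-MR-spec.md a70bf516…: R1
NO HOLE), T-MR-lin/T-MR-fam (kit j337538, T-MR-lin-fam.md b7d5dde9…: wild dim ≥ 4 bed n = 59: R1 6 /
R2∖R1 28 / none 25 = every print-hard phenomenon), census files COSTUME-CENSUS-v2.md 26d74a4c… →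
v4.1. Asides (kind aside, outside the cone of closes, NAMED-RUNG RULE): SandwichedResolveProper
24574 (⟸ SANDʷ kernel; IDEA-NEEDED), SandwichedResolveDimFour 24575 (⟺ WPRIN₄ informal;
IDEA-NEEDED), LinearCentreResolve 24576 (R2; INSTRUMENTABLE dim-bounded only — tribunal n2 asks for
the ringKrullDim ≤ 4 retyping, banked: the dim-4 instrument classes now live in the children as
OrderCut.SplitOrderOneResolveDimFour 27131 / DeepSandwich asides), SuspendedSurfaceResolve 24577
(R1; ATTACKABLE CONFIRMED, census I1: closed mod CossartJannsenSaito2020Embedded + proved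
Kato1994_logRegularScheme_hasResolution_holds + one chart lemma), CPSpecimenResolve 24578
(ATTACKABLE, one blow-up). CHILDREN OF THE RESIDUAL 24572 (cell generations 2–3, each ONE merged
Theses file filed by the writer on a critic CLEARED row, all born DRAFT, tribunal pending, all
re-ask 24572/24573 by signature): route-ResolutionOfSingularities-DeepSandwich (POSITION/confinement
cut: MR ⟸ SandwichConfinement [port, Temkin 2008 Prop 2.3.4 + CP2019] ∧ DeepSandwichResolve 25831
[residual carved to centres of codim ≥ 4 — dim 4: finitely many closed points of a regular
fourfold]; asides PointSandwich/Punctual/Iso₄ 26203/FBR 26947; CRITIC rows 11/14/16/21),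
route-ResolutionOfSingularities-OrderCut (ORDER cut, lens-2 + lens-3 merged: MR ⟸ PencilReduction
[port] ∧ SplitOrderReduction 27127 [residual] ∧ SplitOrderOneResolve 27128; dim-4 rungs SO1R₄ 27131
ATTACKABLE closed-mod-library, Tame₄ 27136 / Wild₄ 27137; rows 13/18/23),
route-ResolutionOfSingularities-QuotientModels (MODELS half, lens-6 trunk + lens-1/3/4 merged:
RegularModels ⟸ GaloisTower [port] ∧ GaloisFixedModels 27194 ∧ HeightOneDescent 27195, exactness
kernel regModel_iff (lens-4 MinimalHeight, Theorems landing p760563 + part 2); rows 19/20/22/24);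
maps CLEARED but not filed separately: TameMultiplicity v2.1 (row 7/8, convergent:
GoodModel/Domination = slices of RR/MR), SpecialFibres (row 16 → aside 26203), AffineCore (row 17 →
p758136), PencilDomination/OrderOneDescent (→ OrderCut),
RadicialLadder/SemistableModels/MinimalHeight (→ QuotientModels). Imported: classical birational
geometry (graphs, blow-ups, Nagata), valuation theory only through Abhyankar's ruledness lemma. No
prior route splits model vs domination (IsolatedCore: singular locus of a dominating model;
valuative frame census A4: valuations with patching on the resolve side; FrobeniusLadder:
F-singularity classes); negatives index (5 entries) untouched.

RANKED CRUXES. #2 SandwichedResolve (crux) — for every prime p, field k of characteristic p, regular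
separated finite-type k-scheme Y and reduced scheme Γ with a separated finite-type BIRATIONAL
morphism b : Γ ⟶ Y, the scheme Γ has a resolution of singularities (MR: dominance without
principalization; DECLARED RESIDUAL; necessity kernel `sandwichedResolve_of_summit`). [difficulty:
open-problem] (why it might fail: cannot fail unless S fails (kernel); as a TARGET MR₄ ⟺ weak
principalization of codim-2 ideals on regular fourfolds, open (Cutkosky2009 p. 3); functorially
summit-equivalent two dimensions down (𝔾_m-fixed-locus certificate).) [Spivakovsky1990,
CossartPiltant2019, Cutkosky2009, Hartshorne1977, Abhyankar1956Valuations, arXiv:math/0207171,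
Piltant2013]
#3 RegularRoofs (crux) — for every prime p, field k of characteristic p and integral separated
finite-type k-scheme X there are a reduced Γ, a regular separated finite-type k-scheme Y, a proper
birational a : Γ ⟶ X and a separated finite-type birational b : Γ ⟶ Y (RR: regular models in roof
form; WEAKER certified; bracketed LU_abs ⟸ RR ⟸ S; necessity kernel `regularRoofs_of_summit`).
[difficulty: open-problem] (why it might fail: cannot fail unless S fails (kernel); open core =
regular MODELS of function fields of dimension ≥ 4 in char p, no lever beyond LU + patching.)
[Cutkosky2009, Zariski1944, Zariski1940, Piltant2013, arXiv:math/0606530]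
#9 asides SandwichedResolveProper, SandwichedResolveDimFour, LinearCentreResolve (R2),
SuspendedSurfaceResolve (R1), CPSpecimenResolve — texts in the item docstrings; kind aside (never
staffed by this route; NAMED-RUNG RULE: they enter the cone only when a piece in the cone imports
them).

TWO-LAYER PLAN. The second layer under the residual now EXISTS as the three child routes above
(position / order / models), each sharing 24572 or 24573 by signature; inside this file nothing is
split (`--refines` schema not live; children are separate Theses files whose module docstrings say
«refines Dominance:24572»). SandwichedResolve ⇐ SandwichedResolveProper ∧ (Nagata compactification
of b + `Scheme.HasResolution.restrict`) and SandwichedResolveProper ⇐ SANDʷ (tree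
`SandwichedWeakResolution`, kernel) remain available to a prover; the rung ladder R1 (ATTACKABLE) ⊂
R2 ⊂ MR₄ ⊂ MR is where depth is earned. RegularRoofs ⇐ (absolute LU) ∧ (abstract patching) foreseen,
not filed; its typed bisection lives in QuotientModels (RegularModels ⟺ PialtModels ∧
HeightOneDescent, kernel regModel_iff).

KILL CRITERIA. Neither crux is refutable without refuting the summit (kernel
`regularRoofs_of_summit`, `sandwichedResolve_of_summit`). The route is retired as COSTUME if someone
proves RegularRoofs → SandwichedResolve (then RR ≡ S) or SandwichedResolve → RegularRoofs (then MR ≡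
S) — BC7/T-RR-a probes found no cheap closure either way, tribunal t1 (a)–(d) not shown; it is
superseded if a route proves resolution of all sandwiched schemes via SANDʷ/SANDᴸ (then MR closes by
`sandwichedResolveProper_of_sandwichedWeakResolution` + Nagata) and only RR remains as the honest
residual «nonsingular models».

NOT DECOMPOSED YET. MR below dimension 4 is known (lens kernel SandwichedResolveDimLE 3 ⟸
CossartPiltant2019; tribunal n3: certificate lives in the lens draft, landing as Theorems requested
from a prover-class seat). Inside MR the critic's NET locates dimension-4 hardness as typed items of
the children: Wild₄ (OrderCut 27137: order ≥ p base points), PGroupFixedModels (QuotientModels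
27205), HeightOneDescent 27195 on the rational bed, Cell(4,4,p)-common-vertex (DeepSandwich punctual
core), QHRes₄(general) = equivariant CP₃ (census T-RR-stab; candidate piece «resolution of fourfolds
with a 𝔾_m-action of complexity one», untyped); everything else typed at dim 4 is closed-mod-library
on ONE printed engine (dim-3 embedded resolution inside a regular fourfold: CP2019 Prop 4.4/4.3,
CJS2020, Cutkosky 2009 Thm 5.1 + Kato1994): SO1R₄ 27131, Cell(4,3,p) and pure-order cells, Tame₄
27136 mod MIR₃^(boundary), NFR₄ 27203, Iso₄ 26203, R1 24577. RR is not split here (its bisection is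
QuotientModels). No scope-split of MR is offered as weaker in this file; by the critic's standard
(b) a dimension/degree/characteristic SLICE of MR is not a WEAKER certificate.

CHEAPEST FALSIFIER. DONE: T-MR-lin (census-1, kit j337538): all 25 print-hard wild dim ≥ 4 germs lie
in MR proper and outside R2 — outcome «kills any MR-is-easier reading; staff only R1» realised,
hence the children; T-MR-spec (desk): R1's 3-step resolution of the CP fourfold has NO HOLE (R1
keeps closed-mod-library). Still the cheapest live check on this file: BC7 probes of both cruxes
against the root (CLEAN ×2 at birth; tribunal t1b no cheap C → S) — rerun if a new Theorems file
lands an implication between the halves.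

NUMBERS. dim ≤ 3: both pieces known (CossartPiltant2019). First open slice: dim 4 (Piltant2013 p. 2;
DimensionFourFrontier). Cutkosky2009: char p > 5 threefolds, RM (Thm 10.1) + principalization (Thm
1.3) ⇒ resolution morphism (Thm 1.1, p. 37). Scope certificate: cones over smooth projective V with
H⁰(V, ω_V) ≠ 0, every dimension ≥ 2, every p. Wild dim ≥ 4 bed: 59 germs (R1 6 / R2∖R1 28 / none
25); models half open on 11 radicial bed fields, vacuous/settled on 113/113 by torus splitting.
Negatives index at filing: 5 statements, none on this axis. Kit spent by the cell through gen 4: ≈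
1.67 core-h.

DEFINITION REQUESTS. None: `Scheme.IsRegular`, `Scheme.HasResolution`, `IsBirational`,
`IsRegularRing`, `topologicalKrullDim`, `ringKrullDim` exist; the pieces are inlined one-liners.

Novelty: Searches (2026-08-30): lit search "sandwiched singularities Nash" --source local (6 docs, all
Nash-problem papers citing Spivakovsky1990; none in dim ≥ 3 char p); lit search --hybrid "resolution
of singularities of rational varieties in positive characteristic dimension four" (6 textbook hits:
hartshorne1977 p.456, kollar2007 pp.122/183, kollar–mori1998, gortz–wedhorn2020,
cossart–jannsen–saito2020 — no dominance theorem); lit galaxy search "sandwiched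
singularities|sandwiched singularity" --star pdf (2 hits: Némethi lattice homology, Morales Nash
problem — surfaces); lit galaxy search "existence of nonsingular models|existence of a nonsingular
model" --star all (1 hit: galaxy:pdf:-8660737924394494020 = Cutkosky2009); lit galaxy search
"elimination of indeterminacy|resolution of indeterminacies" --star pdf (8 hits, none on char-p
resolution); lit read paper:arxiv-math-0606530 pp. 1–3, 34–37 (grep Theorem 9.1/10.1/1.3, patching,
dominat); rg over Theses/ for indeterminac|nonsingular model|regular proper model|RegularModel (only
RuledResidues/ToddIndex certificate decls); ledger negatives --problem ResolutionOfSingularities (5,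
none related); census COSTUME-CENSUS-v1 rows A1, A4, B2, B3, B7, C2, E1, E2, F8, G1 read.
Nearest prior art found: Cutkosky2009 (arXiv:math/0606530) §10 p. 37 — the classical chain RM +
principalization ⇒ resolution morphism in dim 3; the tree's valuative frame
`resolutionOfSingularities_iff_lurel_and_sandwichedLocus` (census A4) whose resolve-conjunct S  [refs: math/0606530, paper:arxiv-math-0606530, Spivakovsky1990, Cutkosky2009]

Barriers (technique_class: birational-geometry, sandwiched, zariski-patching): - technique_class: birational-geometry, sandwiched, zariski-patching
- Literature.Barriers.ResolutionOfSingularities.NashBlowupFailsDimFour: bites MR's only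
scope-specific printed mechanism — the CDLAL toric fourfolds are affine toric, hence sandwiched over
𝔸⁴ (any lattice basis inside σ^∨), so iterated (normalized) Nash blow-ups (Spivakovsky's surface
method) cannot close MR in dim ≥ 4; the line does not use Nash blow-ups; the bet is a chart-wise
mechanism (R1: CJS + log blow-ups) climbing the linear-centre ladder.
- Literature.Barriers.ResolutionOfSingularities.hauserPerlega_mohProofBoundFails: constrains
invariant-steered blow-up strategies inside MR's general charts (R2∖R1, MR₄) exactly as for the
root; it does not quantify over RegularRoofs (no invariant, no blow-up sequence) nor over the rung
R1 (after CJS on V(h) the equation is the binomial u v^m = y^a, resolved by one log blow-up — the CP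
Remark-3.2 specimen, where DimensionFourFrontier records invariant failure, lies in R1 and even
falls to one blow-up); it does not evade it on MR; the bet is that MR's extra structure (a
birational morphism to a regular Y, all exceptional divisors ruled) is usable input no
invariant-only strategy has.
- Literature.Barriers.ResolutionOfSingularities.Hauser2003_kangarooShadeIncrease: same placement as
hauserPerlega_mohProofBoundFails (inside MR's general charts only; not over RR, not over the rung
R1).
- Literature.Barriers.ResolutionOfSingularities.DimensionFourFrontier: consistent —

History (route lifecycle, newest last):
- 2026-08-30T04:23:55Z · rev 2: informal re-worded for SandwichedResolve (planner-decomp-res-writer-1-g2-0)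
- 2026-08-30T04:24:25Z · rev 3: informal re-worded for RegularRoofs (planner-decomp-res-writer-1-g2-0)
- 2026-08-30T04:40:09Z · rev 5: informal re-worded for CPSpecimenResolve (planner-decomp-res-writer-1-g2-0)

sub-problem: ResolutionOfSingularities · status: open · opened planner-decomp-res-lens-4-g0-0 2026-08-30T01:52:17Z · rev 10 · ledger route-ResolutionOfSingularities-Dominance
GENERATED by the gate from the ledger (D-0016/17). Provers cite these decls: `theorem foo : Summit.ResolutionOfSingularities.ResolutionOfSingularities.Theses.Dominance.<Decl> := …` in Summits/ResolutionOfSingularities/ResolutionOfSingularities/Theorems/<Name>.lean.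
-/

namespace Summit.ResolutionOfSingularities.ResolutionOfSingularities.Theses.Dominance

open scoped BigOperators Topology Manifold Classical MeasureTheory ProbabilityTheory Matrix InnerProductSpace ComplexConjugate ContinuousMap
open Filter Set Function TopologicalSpace MeasureTheory

attribute [summit_statement] _root_.ResolutionOfSingularities

/-- item stmt-ResolutionOfSingularities-24572 · crux · rank 2 · open · by planner
why it might fail: cannot fail unless S fails (kernel); as a TARGET MR₄ ⟺ weak principalization of codim-2 ideals on regular fourfolds, open (Cutkosky2009 p. 3) — the node's RESIDUAL, UNDECIDED; the CP fourfold Z^p+u₄u₁^p+u₃u₂^p is inside the scope but in the solved rung R1 (m = p).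
sources: Spivakovsky1990, CossartPiltant2019, Cutkosky2009, Hartshorne1977, Abhyankar1956Valuations, arXiv:math/0207171
[crux] for every prime p, field k of characteristic p, regular separated finite-type k-scheme Y and
reduced scheme Γ with a separated finite-type BIRATIONAL morphism b : Γ ⟶ Y, the scheme Γ has a
resolution of singularities (MR: dominance without principalization; necessity kernel
`sandwichedResolve_of_summit`). BOOKING (critic decomp-res-crit-1 row 6 + ERRATUM 02:58Z; tribunal
census-trib-res-1 02:36Z SPLIT-WITH-RESIDUAL): the route's DECLARED RESIDUAL — NECESSARY ✓ ·
UNDECIDED(costume-risk) both ways: MR ⟹ S unknown (absorption = RegularRoofs, open), S ⟹ MR kernel;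
FUNCTORIALLY summit-equivalent two dimensions down (𝔾_m-fixed-locus certificate: an
equivariant/functorial proof of MR_m resolves every (m−2)-dimensional hypersurface), bare transfer
open; the one-dimension-down reading via the suspension Q_(h,N) = {u·x₁^N = h} is WITHDRAWN (no
descent to Cartier slices in char p) while MR ⊇ Q_(h,N) ⊇ the Cossart–Piltant Remark 3.2 fourfold
stands; no separating class can exist inside MR's scope (the scope certificate — cones over
non-ruled V — lies outside it); census T-MR-lin (kit j337538): all 25 print-hard wild dim ≥ 4 germs
lie in MR proper, outside R2. ORDER CERTIFICATE in tree: -/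
@[route_item "route-ResolutionOfSingularities-Dominance", crux]
def SandwichedResolve : Prop :=
  ∀ p : ℕ, p.Prime → ∀ (k : Type) [Field k] [CharP k p] (Y : AlgebraicGeometry.Scheme.{0}) (g : Y ⟶ AlgebraicGeometry.Spec (.of k)), AlgebraicGeometry.IsSeparated g → AlgebraicGeometry.LocallyOfFiniteType g → AlgebraicGeometry.QuasiCompact g → Literature.AlgebraicGeometry.Resolution.Scheme.IsRegular Y → ∀ (Γ : AlgebraicGeometry.Scheme.{0}) (b : Γ ⟶ Y), AlgebraicGeometry.IsSeparated b → AlgebraicGeometry.LocallyOfFiniteType b → AlgebraicGeometry.QuasiCompact b → Literature.AlgebraicGeometry.Resolution.IsBirational b → AlgebraicGeometry.IsReduced Γ → Literature.AlgebraicGeometry.Resolution.Scheme.HasResolution Γ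

/-- item stmt-ResolutionOfSingularities-24573 · crux · rank 3 · open · by planner
why it might fail: cannot fail unless S fails (kernel); WEAKER by separating witness: a theorem on every sandwiched X (`roof_of_sandwiched`) and every X with a known smooth model (rational fields ∋ the CP fourfold), where S is open from dim 4; open core = nonsingular MODELS of dim ≥ 4 function fields.
sources: Cutkosky2009, Zariski1944, Zariski1940, Piltant2013, arXiv:math/0606530
[crux] for every prime p, field k of characteristic p and integral separated finite-type k-scheme X
there are a reduced Γ, a regular separated finite-type k-scheme Y, a proper birational a : Γ ⟶ X and
a separated finite-type birational b : Γ ⟶ Y (RR: regular models in roof form; necessity kernel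
`regularRoofs_of_summit`; bracketed LU_abs ⟸ RR ⟸ S for proper X). BOOKING (critic row 6; tribunal
02:36Z): the ATTACKED conjunct — NECESSARY ✓ · WEAKER CERTIFIED by a separating CLASS (RR is a
theorem on every sandwiched X — lens kernel `roof_of_sandwiched` — and on every X whose function
field has a regular proper model, by graph closure + Nagata: all rational X, every pencil graph {u·g
= h}, Bl_I 𝔸⁴, the Cossart–Piltant fourfold — a class on which S is OPEN from dimension 4) ·
junk-free · IDEA-NEEDED (open core = regular proper models of function fields of transcendence
degree ≥ 4 in char p; no lever in print beyond local uniformization + patching, Cutkosky2009 p. 3).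
In ProperModel language RR(proper X) ⟺ `ProperModel.RegModel` (tree A7 half); its typed bisection
RegModel ⟺ PialtModels ∧ HeightOneDescent is kernel
(`Theorems.QuotientModelsMinimalHeight.regModel_iff`, p760563) and is rou -/
@[route_item "route-ResolutionOfSingularities-Dominance", crux]
def RegularRoofs : Prop :=
  ∀ p : ℕ, p.Prime → ∀ (k : Type) [Field k] [CharP k p] (X : AlgebraicGeometry.Scheme.{0}) (f : X ⟶ AlgebraicGeometry.Spec (.of k)), AlgebraicGeometry.IsSeparated f → AlgebraicGeometry.LocallyOfFiniteType f → AlgebraicGeometry.QuasiCompact f → AlgebraicGeometry.IsIntegral X → ∃ (Γ Y : AlgebraicGeometry.Scheme.{0}) (a : Γ ⟶ X) (b : Γ ⟶ Y) (g : Y ⟶ AlgebraicGeometry.Spec (.of k)), AlgebraicGeometry.IsSeparated g ∧ AlgebraicGeometry.LocallyOfFiniteType g ∧ AlgebraicGeometry.QuasiCompact g ∧ Literature.AlgebraicGeometry.Resolution.Scheme.IsRegular Y ∧ AlgebraicGeometry.IsReduced Γ ∧ AlgebraicGeometry.IsProper a ∧ Literature.AlgebraicGeometry.Resolution.IsBirational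 a ∧ AlgebraicGeometry.IsSeparated b ∧ AlgebraicGeometry.LocallyOfFiniteType b ∧ AlgebraicGeometry.QuasiCompact b ∧ Literature.AlgebraicGeometry.Resolution.IsBirational b

/-- item stmt-ResolutionOfSingularities-24574 · aside · rank 9 · open · by planner
sources: CossartPiltant2019, Piltant2013
[support] MR in PROPER form with integral data (Γ integral, b : Γ ⟶ Y proper birational, Y regular
integral) — the classical sandwiched class; implied by MR (kernel
`sandwichedResolveProper_of_sandwichedResolve`), by SANDʷ at V = ⊤ and by SAND⁺ (kernel); gives MR
back modulo Nagata compactification of b (informal). To be filed as `aside` (BC6: not consumed by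
closes). [difficulty: open-problem] -/
@[route_item "route-ResolutionOfSingularities-Dominance", crux]
def SandwichedResolveProper : Prop :=
  ∀ p : ℕ, p.Prime → ∀ (k : Type) [Field k] [CharP k p] (Y : AlgebraicGeometry.Scheme.{0}) (g : Y ⟶ AlgebraicGeometry.Spec (.of k)), AlgebraicGeometry.IsSeparated g → AlgebraicGeometry.LocallyOfFiniteType g → AlgebraicGeometry.QuasiCompact g → AlgebraicGeometry.IsIntegral Y → Literature.AlgebraicGeometry.Resolution.Scheme.IsRegular Y → ∀ (Γ : AlgebraicGeometry.Scheme.{0}) (b : Γ ⟶ Y), AlgebraicGeometry.IsIntegral Γ → AlgebraicGeometry.IsProper b → Literature.AlgebraicGeometry.Resolution.IsBirational b → Literature.AlgebraicGeometry.Resolution.Scheme.HasResolution Γ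

/-- item stmt-ResolutionOfSingularities-24575 · aside · rank 9 · open · by planner
sources: CossartPiltant2019, Piltant2013
[support] MR sliced at topologicalKrullDim Γ ≤ 4 — the FIRST OPEN SLICE (dim ≤ 3 is
CossartPiltant2019, kernel `sandwichedResolveDimLE_three`); contains the Cossart–Piltant wild
specimen chart; IDEA-NEEDED. To be filed as `aside`. [difficulty: open-problem] -/
@[route_item "route-ResolutionOfSingularities-Dominance"]
def SandwichedResolveDimFour : Prop :=
  ∀ p : ℕ, p.Prime → ∀ (k : Type) [Field k] [CharP k p] (Y : AlgebraicGeometry.Scheme.{0}) (g : Y ⟶ AlgebraicGeometry.Spec (.of k)), AlgebraicGeometry.IsSeparated g → AlgebraicGeometry.LocallyOfFiniteType g → AlgebraicGeometry.QuasiCompact g → Literature.AlgebraicGeometry.Resolution.Scheme.IsRegular Y → ∀ (Γ : AlgebraicGeometry.Scheme.{0}) (b : Γ ⟶ Y), AlgebraicGeometry.IsSeparated b → AlgebraicGeometry.LocallyOfFiniteType b → AlgebraicGeometry.QuasiCompact b → Literature.AlgebraicGeometry.Resolution.IsBirational b → AlgebraicGeometry.IsReduced Γ → topologicalKrullDim Γ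 ≤ 4 → Literature.AlgebraicGeometry.Resolution.Scheme.HasResolution Γ

/-- item stmt-ResolutionOfSingularities-24576 · aside · rank 9 · open · by planner
sources: CossartPiltant2019, Hartshorne1977
[support] R2, the linear-centre class: for A a regular finite-type k-domain and g ≠ 0, h ∈ A with
A[u]/(u·g − h) a domain, Spec A[u]/(u·g − h) (main chart of the blow-up of Spec A along (g, h),
birational over Spec A) has a resolution; INSTRUMENTABLE (census test T-MR-lin) and IDEA-NEEDED
(contains A = k[Z,u₁,u₂,u₃], g = u₁^p, h = −(Z^p + u₃u₂^p)); necessity kernel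
`linearCentreResolve_of_summit`. To be filed as `aside`. [difficulty: open-problem] -/
@[route_item "route-ResolutionOfSingularities-Dominance"]
def LinearCentreResolve : Prop :=
  ∀ p : ℕ, p.Prime → ∀ (k : Type) [Field k] [CharP k p] (A : Type) [CommRing A] [IsDomain A] [Algebra k A], Algebra.FiniteType k A → IsRegularRing A → ∀ g h : A, g ≠ 0 → IsDomain (Polynomial A ⧸ Ideal.span {Polynomial.C g * Polynomial.X - Polynomial.C h}) → Literature.AlgebraicGeometry.Resolution.Scheme.HasResolution (AlgebraicGeometry.Spec (.of (Polynomial A ⧸ Ideal.span {Polynomial.C g * Polynomial.X - Polynomial.C h})))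

/-- item stmt-ResolutionOfSingularities-24577 · aside · rank 9 · open · by planner
sources: CossartJannsenSaito2020, Kato1994, Niziol2006, IllusieTemkin2014ExpVIII, CossartPiltant2019
[support] R1, monomial suspensions: for B a regular finite-type k-domain of Krull dimension ≤ 3, h ≠
0 and any m with B[u,v]/(u·v^m − h) a domain, Spec B[u,v]/(u·v^m − h) has a resolution (fourfolds
when dim B = 3, outside CossartPiltant2019; m = p, B = k[Z,u₂,u₃], h = −(Z^p + u₃u₂^p) is the
Cossart–Piltant Remark 3.2 fourfold); ATTACKABLE closed-mod-library: (1) embedded resolution with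
boundary of the surface V(h) ⊂ Spec B (CossartJannsenSaito2020) makes h = ε·y^a locally; (2) the
base change is proper birational (flat family of plane curves, integral total space); (3) u·v^m = ε
y^a is Zariski-locally the flat base change of the prime binomial (affine toric) u v^m = y^a along
the parameter map, whose saturation is log-regular by Kato's criterion, resolved by a log blow-up
(Kato1994 (10.4); any field); necessity kernel `suspendedSurfaceResolve_of_summit`. The BC5 rung of
MR; filed `aside`. [difficulty: L] -/
@[route_item "route-ResolutionOfSingularities-Dominance"]
def SuspendedSurfaceResolve : Prop :=
  ∀ p : ℕ, p.Prime → ∀ (k : Type) [Field k] [CharP k p] (B : Type) [CommRing B] [IsDomain B] [Algebra k B], Algebra.FiniteType k B → IsRegularRing B → ringKrullDim B ≤ 3 → ∀ h : B, h ≠ 0 → ∀ m : ℕ, IsDomain (MvPolynomial (Fin 2) B ⧸ Ideal.span {MvPolynomial.X 0 * MvPolynomial.X 1 ^ m - MvPolynomial.C h}) → Literature.AlgebraicGeometry.Resolution.Scheme.HasResolution (AlgebraicGeometry.Spec (.of (MvPolynomial (Fin 2) B ⧸ Ideal.span {MvPolynomial.X 0 * MvPolynomial.X 1 ^ m - MvPolynomial.C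 h})))

/-- item stmt-ResolutionOfSingularities-24578 · aside · rank 9 · open · by planner
sources: CossartPiltant2019, CossartJannsenSaito2020, Kato1994, Niziol2006
[support] [TAGS · aside (outside the cone; NAMED-RUNG RULE) · ATTACKABLE · PROVER TARGET — critic
row 41 (2026-08-30T04:32:05Z): «the CHEAPEST REAL THEOREM in the cell», two independent closings on
paper: (i) ONE blow-up of the singular plane {Z = u₁ = u₂ = 0} resolves it (charts Z'^p + u₄ +
u₃u₂'^p and Z'^p + u₄u₁'^p + u₃ smooth, Z-chart non-singular; lens-3 REPAIR-CENSUS, re-checked by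
the critic), (ii) torus-complexity ONE: the specimen is weighted-homogeneous for a rank-3 weight
table (lens-6 g4 TorusDescent: kernels cpSpecimenResolve_of_torusLeOne / cpSpecimenResolve_of_gmPos
⇒ this item from TorusHypersurfaceResolveLeOne resp. GmFourfoldResolvePos 27821), closable modulo
TorusQuotientDescentLeOne = Langlois 2015 pp-divisors over arbitrary fields + normalisation of
curves + toroidal criterion + tree-PROVED Kato1994_logRegularScheme_hasResolution_holds — no CP2019,
no CJS; also the m = p instance of SuspendedSurfaceResolve 24577 (R1) · NECESSARY (kernel
cpSpecimenResolve_of_summit) · census T-MR-spec (HOME/census/T-MR-spec.md a70bf516…): NO HOLE in the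
3-step R1 resolution · Literature wording debt: WildPurity.lean:144 «non-quasi-homogeneous» is false
as worded (the specimen is -/
@[route_item "route-ResolutionOfSingularities-Dominance"]
def CPSpecimenResolve : Prop :=
  ∀ p : ℕ, p.Prime → ∀ (k : Type) [Field k] [CharP k p], IsDomain (MvPolynomial (Fin 5) k ⧸ Ideal.span {Literature.Barriers.ResolutionOfSingularities.cpRemark32Poly k p}) → Literature.AlgebraicGeometry.Resolution.Scheme.HasResolution (AlgebraicGeometry.Spec (.of (MvPolynomial (Fin 5) k ⧸ Ideal.span {Literature.Barriers.ResolutionOfSingularities.cpRemark32Poly k p})))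

/-- item stmt-ResolutionOfSingularities-27821 · aside · rank 9 · open · by planner
why it might fail: cannot fail unless S fails (necessity kernel); as a TARGET the only risk is the port: toroidality => log-regularity over a regular (not smooth) base with snc boundary in char p is printed over C only (Liendo-Suess 2013 Prop 2.6); substance = Kato's criterion, characteristic-free.
sources: arXiv:2506.22734, arXiv:1005.2462, arXiv:2512.22432, doi:10.1016/j.jalgebra.2019.02.017, CossartJannsenSaito2020, Kato1994
[support] [TAGS · aside (outside the cone of closes; NAMED-RUNG RULE) · S-side RUNG by torus
complexity, lens-6 g4 TorusDescent (HOME/decomp-res-lens-6/g4/TorusDescent.lean sha256 5f10a568…;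
convergent lens-3 g4 ConeLadder 80757d8d…: = kernel-instance of ConeRes 4) · CRITIC CLEARED row 41
2026-08-30T04:32:05Z: ATTACKABLE NOW · KNOWN-MOD-PORT(S–M, ALL fields) · NECESSARY (instance of S;
kernel gmFourfoldResolvePos_of_summit in the lens file) · PROVER TARGET (flagged by the critic; with
24578 the cheapest real theorems of the cell) · census T-cone-pos 04:31:09Z / lens-3 cone census:
covers 48 of the 53 dim-4 open-regime bed germs incl. all 10 «hard» single-𝔾ₘ germs (the other 5 are
surface × 𝔸²)] (lens tags: aside · ATTACKABLE NOW · KNOWN-MOD-PORT(S–M) · NECESSARY) T-torus-1: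
every quasi-homogeneous (all weights > 0) prime F in k[x0..x4], any field k of char p, defines a
fourfold V(F) with a resolution. Covers the fourfolds of the cell's wild dim-4 bed
(T-RR-rho/T-RR-stab: 59 open-regime germs, all of torus complexity <= 3; the 10 'hard' single-G_m
germs have positive weights). Port: normalise (graded), Demazure A = (+)_n H^0(Y, O(floor nD)) on
the threefold Y = Proj A, log-resolve ( -/
@[route_item "route-ResolutionOfSingularities-Dominance"]
def GmFourfoldResolvePos : Prop :=
  ∀ p : ℕ, p.Prime → ∀ (k : Type) [Field k] [CharP k p] (w : Fin 5 → ℤ) (F : MvPolynomial (Fin 5) k) (m : ℤ), (∀ i, 0 < w i) → MvPolynomial.IsWeightedHomogeneous w F m → IsDomain (MvPolynomial (Fin 5) k ⧸ Ideal.span {F}) → Literature.AlgebraicGeometry.Resolution.Scheme.HasResolution (AlgebraicGeometry.Spec (.of (MvPolynomial (Fin 5) k ⧸ Ideal.span {F})))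

/-- item stmt-ResolutionOfSingularities-27822 · aside · rank 9 · open · by planner
why it might fail: cannot fail unless S fails; as a TARGET: over imperfect k the split-torus AH construction for non-geometrically-normal X is not printed (Martinez-Nunez 2025 Thm 4.1 assumes geometric normality) — a port gap, not a counterexample.
sources: arXiv:2506.22734, arXiv:1207.0208, arXiv:1005.2462, doi:10.1016/j.jalgebra.2019.02.017, CossartJannsenSaito2020, Kato1994
[support] [TAGS · aside (outside the cone; NAMED-RUNG RULE) · lens-6 g4 TorusDescent · CRITIC
CLEARED row 41: ATTACKABLE · KNOWN-MOD-PORT(M–L; honest gap P3 = geometric normality over imperfect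
k, Martinez-Nunez 2025 Thm 4.1) · NECESSARY · = the census/critic-named piece «resolution of
𝔾ₘ-fourfolds» (critic 04:09:55Z), hypersurface form; the critic's earlier «equivariant CP₃ ⇒
IDEA-NEEDED» reading is WITHDRAWN (ERRATUM row 41: quotient-pair descent needs no equivariance)]
(lens tags: aside · ATTACKABLE · KNOWN-MOD-PORT(M–L; imperfect ground fields UNDECIDED-in-print) ·
NECESSARY) the census-named piece 'resolution of fourfolds with G_m-action' (critic 04:09:55Z),
hypersurface form: prime F in k[x0..x4] weighted-homogeneous for some nonzero integer weight
(equivalently: Newton support in an affine hyperplane; automatic for <= 5 monomials). Port: rank-one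
Altmann-Hausen (hyperbolic Demazure) presentation over the threefold GIT quotient (Martinez-Nunez
2025 Thm 4.1 over arbitrary fields; needs X geometrically normal: automatic over perfect k) + CP2019
+ CJS + toroidal/Kato. Implies GmFourfoldResolvePos; implied by TorusHypersurfaceResolveLeThree.
[difficulty: L] -/
@[route_item "route-ResolutionOfSingularities-Dominance"]
def GmFourfoldResolve : Prop :=
  ∀ p : ℕ, p.Prime → ∀ (k : Type) [Field k] [CharP k p] (w : Fin 5 → ℤ) (F : MvPolynomial (Fin 5) k) (m : ℤ), w ≠ 0 → MvPolynomial.IsWeightedHomogeneous w F m → IsDomain (MvPolynomial (Fin 5) k ⧸ Ideal.span {F}) → Literature.AlgebraicGeometry.Resolution.Scheme.HasResolution (AlgebraicGeometry.Spec (.of (MvPolynomial (Fin 5) k ⧸ Ideal.span {F})))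

/-- item stmt-ResolutionOfSingularities-27823 · aside · rank 9 · open · by planner
why it might fail: cannot fail unless S fails; as a TARGET: port gap over imperfect ground fields (geometric normality in MN25 Thm 4.1) and the char-p toroidality-to-log-regularity step printed over C only; no mathematical obstruction known (dim-2 analogue in all characteristics: Orlik-Wagreich 1977).
sources: arXiv:2506.22734, arXiv:2512.22432, arXiv:1005.2462, doi:10.1016/j.jalgebra.2019.02.017, CossartJannsenSaito2020, Kato1994
[support] [TAGS · aside (outside the cone; NAMED-RUNG RULE) · lens-6 g4 TorusDescent THR(p,≤3) ·
CRITIC CLEARED row 41: WEAKER = decided-mod-port instances of S · ATTACKABLE · KNOWN-MOD-PORT(L) ·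
NECESSARY · ⟹ GmFourfoldResolve ⟹ GmFourfoldResolvePos (kernels in the lens file); consequence
booked by the critic: the ENTIRE held wild dim-4 bed (59/59 open-regime germs, torus complexity ≤ 3;
lens-3 exact census 53 cone + 6 parabolic) is S-side DECIDED-MOD-PORT, so S-side specimens must be
torus-free (Newton support of affine rank 5, ≥ 6 monomials: on the shelves only MODELS-BED-v0
M1–M5); TorusHypersurfaceResolveAll (all complexities) is S re-indexed — name only, not filed] (lens
tags: aside · WEAKER · ATTACKABLE · KNOWN-MOD-PORT(L) · NECESSARY) THR(p,<=3): affine hypersurfaces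
V(F) in A^N_k of ANY dimension, F prime and weighted-homogeneous for a weight table w : Fin N -> Z^s
whose Q-span has rank rho >= N-4, i.e. a split torus acts with COMPLEXITY (quotient dimension) <= 3,
have resolutions. The barrier-complement class of lens 6 (symmetry): the resolving modification is
quotient descent (Altmann-Hausen pp-divisor on the <=3-dimensional quotient Y) + NON-equivariant
CP2019/CJS on (Y -/
@[route_item "route-ResolutionOfSingularities-Dominance"]
def TorusHypersurfaceResolveLeThree : Prop :=
  ∀ p : ℕ, p.Prime → ∀ (k : Type) [Field k] [CharP k p] (N s : ℕ) (w : Fin N → Fin s → ℤ) (F : MvPolynomial (Fin N) k) (m : Fin s → ℤ), MvPolynomial.IsWeightedHomogeneous w F m → N ≤ Module.finrank ℚ (Submodule.span ℚ (Set.range fun i : Fin N => fun j : Fin s => (w i j : ℚ))) + 3 + 1 → IsDomain (MvPolynomial (Fin N) k ⧸ Ideal.span {F}) → Literature.AlgebraicGeometry.Resolution.Scheme.HasResolution (AlgebraicGeometry.Spec (.of (MvPolynomial (Fin N) k ⧸ Ideal.span {F})))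

/-- item stmt-ResolutionOfSingularities-27824 · aside · rank 9 · open · by planner
why it might fail: port only: Demazure's theorem (normal N-graded rings, A_0 a field, any characteristic), CP2019 Thm 1.1 (i)-(iii), CJS Thm 1.4 with boundary, local cone-algebra presentation R (x)_{k[t]} k[S] and Kato's regularity criterion.
sources: doi:10.1017/s0027763000019498, arXiv:math/0208226, doi:10.1016/j.jalgebra.2019.02.017, CossartJannsenSaito2020, arXiv:1005.2462, Kato1994
[support] [TAGS · typed `support` by the lens, FILED AS ASIDE (outside the cone of closes;
NAMED-RUNG RULE — becomes support only when a piece in the cone imports it) · lens-6 g4 TorusDescent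
· CRITIC CLEARED row 41: COSTUME(cite) · PORT S–M (Demazure Thm 3.5 / Watanabe NMJ 83 char-free;
CP2019 Thm 1.1 (i)–(iii) STRONG; CJS2020 Thm 1.4 with boundary; toroidal ⇒ Kato log-regular,
combinatorial; AH Thm 3.1/3.4 properness) · kernel GmConeDescentPos → GmFourfoldResolvePos =
tree-PROVED Kato1994_logRegularScheme_hasResolution_holds + Scheme.HasResolution.of_isBirational
(lens file gmFourfoldResolvePos_of_descent); lens-3 ConeLadder types the same port once over
LogRegularAtlas as ConeLogModel n (8 steps, 3 weakest links; census 04:31:09Z «PORT OWED» answered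
there)] (lens tags: support · COSTUME(cite) · PORT S–M) the Demazure cone descent: for a
quasi-homogeneous prime F in k[x0..x4] there is a proper birational pi : X2 -> V(F) with X2
quasi-compact and Kato log-regular (X2 = Spec_Y' (+)_n O(floor n psi^*D) over a log resolution psi
of (Proj A^nu, supp D_frac)). Kernel to GmFourfoldResolvePos = Kato (10.4), PROVED in the tree
(Kato1994_logRegularScheme_hasResolution_holds) + Scheme.HasR -/
@[route_item "route-ResolutionOfSingularities-Dominance"]
def GmConeDescentPos : Prop :=
  ∀ p : ℕ, p.Prime → ∀ (k : Type) [Field k] [CharP k p] (w : Fin 5 → ℤ) (F : MvPolynomial (Fin 5) k) (m : ℤ), (∀ i, 0 < w i) → MvPolynomial.IsWeightedHomogeneous w F m → IsDomain (MvPolynomial (Fin 5) k ⧸ Ideal.span {F}) → ∃ (X₂ : AlgebraicGeometry.Scheme.{0}) (π : X₂ ⟶ AlgebraicGeometry.Spec (.of (MvPolynomial (Fin 5) k ⧸ Ideal.span {F}))), AlgebraicGeometry.IsProper π ∧ Literature.AlgebraicGeometry.Resolution.IsBirational π ∧ CompactSpace X₂ ∧ Literature.AlgebraicGeometry.Resolution.Scheme.IsLogRegular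 X₂

/-- item stmt-ResolutionOfSingularities-28301 · aside · rank 9 · open · by planner
sources: doi:10.1007/978-4-431-56837-7, doi:10.1007/BF01076254, arXiv:math/0210153, CossartPiltant2019
[aside] [TAGS · aside (outside the cone of closes (hR : RegularRoofs) (hS : SandwichedResolve);
NAMED-RUNG RULE, rung currency 0) · lens-1 g4 NewtonLadder
(HOME/decomp-res-lens-1/g4/NewtonLadder.lean sha256 3504f2d3…; instrument newton/T-newton-0.md
cd09d16c…, psing_faces.py e6771306…; census data HOME/census/COSTUME-CENSUS-v5.json sha256
53160be5…) · CRITIC row 29 2026-08-30T04:51:09Z «CLEARED AS MAP + LETTER; one aside HypNewtonRes 4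
on Dominance OK (writer); instrument correction requested» · by-name: = NewtonLadder.HypNewtonRes 4
with TorusSmooth / IsNewtonNondegenerate INLINED (writer scratch nl/ItemsCheckDom.lean:
`hypNewtonResDimFour_iff : HypNewtonResDimFour ↔ HypNewtonRes 4 := Iff.rfl`, necessity
`hypNewtonResDimFour_of_summit`, rc 0) · leaf tag ATTACKABLE (prover-attackable port) · verdict
WEAKER (instances of S decided mod port) · KNOWN-MOD-PORT(M)] NEWTON LETTER of the hypersurface bed
in dimension 4: every prime F ∈ k[x₀..x₄] (char p, ANY field k) that is NEWTON NON-DEGENERATE in the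
global form over the fan of 𝔸⁵ — for every weight w : Fin 5 → ℕ (w = 0 included) the initial form
in_w F (weighted-homogeneous component of minimal w-weight) is smooth on the torus 𝔾_m⁵ at -/
@[route_item "route-ResolutionOfSingularities-Dominance"]
def HypNewtonResDimFour : Prop :=
  ∀ p : ℕ, p.Prime → ∀ (k : Type) [Field k] [CharP k p] (F : MvPolynomial (Fin 5) k), F ≠ 0 → (Ideal.span {F}).IsPrime → (∀ (w : Fin 5 → ℕ) (m : ℕ), (∃ μ ∈ F.support, Finsupp.weight w μ = m) → (∀ μ ∈ F.support, m ≤ Finsupp.weight w μ) → ∀ (K : Type) [Field K] [Algebra k K] (x : Fin 5 → K), (∀ i, x i ≠ 0) → MvPolynomial.aeval x (MvPolynomial.weightedHomogeneousComponent w m F) = 0 → ∃ i, MvPolynomial.aeval x (MvPolynomial.pderiv i (MvPolynomial.weightedHomogeneousComponent w m F)) ≠ 0) → Literature.AlgebraicGeometry.Resolution.Scheme.HasResolution (AlgebraicGeometry.Spec (.of (MvPolynomial (Fin 5) k ⧸ Ideal.span {F})))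

/-- item stmt-ResolutionOfSingularities-29543 · aside · rank 9 · open · by planner
sources: CossartPiltant2019, DeJong1996, AbramovichJong1996
[aside] [TAGS · aside (outside the cone of closes (hR : RegularRoofs) (hS : SandwichedResolve);
NAMED-RUNG RULE) · node GaloisWeb = lens-4 g6 (HOME/decomp-res-lens-4/g6/GaloisWeb.lean sha256
62269666e3f28ddf) · CRITIC row 41 06:08:04Z «CLEARED AS CHILD NODE with decided carving; writer
asides + kernels»; notions Theorems/GaloisWebClasses.lean p763987; kernels
Theorems/DominanceGaloisWeb.lean] TARGET SLICE of the node · WEAKER(evidence: necessary from ROOT,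
kernel target_of_root; = verbatim the hypothesis of FactorialLadder.DescentFour stmt-23684;
sufficient with 23684 ∧ FactorialLadder.ResGeFive 23685: kernel root_of) · layer 1: ⟸
CossartPiltant2019 ∧ WebNormalForm ∧ TameWebResolve ∧ WildWebResolve (closes), EXACT mod ports:
target_iff. Weak resolution up to dimension 4 over every algebraically closed field of
characteristic p. Why novel: the dim-4 k̄ slice is cut by the Galois curve-web (de Jong's families
of curves made G-equivariant over a 3-dimensional base) into a decided TAME class and a located WILD
residual. -/
@[route_item "route-ResolutionOfSingularities-Dominance"]
def ResolutionDimFourAlgClosed : Prop :=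
  ∀ p : ℕ, p.Prime → ∀ (k : Type) [Field k] [IsAlgClosed k] [CharP k p], Literature.AlgebraicGeometry.Resolution.ResolutionOverUpToDim.{0} k 4

/-- item stmt-ResolutionOfSingularities-29544 · aside · rank 9 · open · by planner
sources: DeJong1996, AbramovichJong1996, CossartPiltant2019, CossartJannsenSaito2020
[aside] [TAGS · aside (outside the cone of closes (hR : RegularRoofs) (hS : SandwichedResolve);
NAMED-RUNG RULE) · node GaloisWeb = lens-4 g6 (HOME/decomp-res-lens-4/g6/GaloisWeb.lean sha256
62269666e3f28ddf) · CRITIC row 41 06:08:04Z «CLEARED AS CHILD NODE with decided carving; writer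
asides + kernels»; notions Theorems/GaloisWebClasses.lean p763987; kernels
Theorems/DominanceGaloisWeb.lean] piece N · KNOWN-MOD-PORT (critic: «N port ok (quotient-level base,
CP+CJS)») · UNDECIDED(necessity from S unknown: a structure theorem, in-cone only through closes'
wild branch) · leaf INSTRUMENTABLE (port: de Jong 1996 4.11–4.22 projection/three-point lemma/stable
extension, AdJ 1997 §2.1–2.2 G-action lift, Raynaud–Gruson flattening, CP2019 Prop. 4.4 + CJS2020
Thm. 6.9 replacing AdJ's inductive assumption on (P, Δ)). Every integral projective X/k̄ of
dimension exactly 4 admits a Galois web (HasWeb k X): it is dominated birationally by the quotient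
X₂/G of a G-equivariant semi-stable curve over the normalisation Y₂ of a regular snc threefold pair
(Y, D) in a Galois extension, étale off D. -/
@[route_item "route-ResolutionOfSingularities-Dominance"]
def WebNormalForm : Prop :=
  ∀ p : ℕ, p.Prime → ∀ (k : Type) [Field k] [IsAlgClosed k] [CharP k p] (n : ℕ) (X : AlgebraicGeometry.Scheme.{0}) (ι : X ⟶ (Literature.AlgebraicGeometry.Motives.projectiveSpace n k).left), AlgebraicGeometry.IsClosedImmersion ι → AlgebraicGeometry.IsIntegral X → topologicalKrullDim X ≤ 4 → ¬ topologicalKrullDim X ≤ 3 → Summit.ResolutionOfSingularities.ResolutionOfSingularities.Theorems.GaloisWebClasses.HasWeb k X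

/-- item stmt-ResolutionOfSingularities-29545 · aside · rank 9 · open · by planner
sources: AbramovichJong1996, DeJong1996, Kato1994, CossartPiltant2019
[aside] [TAGS · aside (outside the cone of closes (hR : RegularRoofs) (hS : SandwichedResolve);
NAMED-RUNG RULE) · node GaloisWeb = lens-4 g6 (HOME/decomp-res-lens-4/g6/GaloisWeb.lean sha256
62269666e3f28ddf) · CRITIC row 41 06:08:04Z «CLEARED AS CHILD NODE with decided carving; writer
asides + kernels»; notions Theorems/GaloisWebClasses.lean p763987; kernels
Theorems/DominanceGaloisWeb.lean] piece T · KNOWN-MOD-PORT (critic: «function-field carving (e)(i);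
HasTameWeb upward-closed; Abhyankar ⇒ Kummer-toroidal base, no equivariant dim-3 resolution needed;
AdJ char-p steps = PORT L–XL on authors' remarks») · WEAKER(evidence: necessary from the target
slice, kernel tame_of_target) · leaf INSTRUMENTABLE (port L–XL: AdJ 1997 §2.3–2.5/Rem. 2.10 tame
stabilisers ⇒ toroidal, Kato 1994 Thm. 8.2 = tree Kato1994_logRegularScheme_hasResolution_holds,
Scheme.HasResolution.of_isBirational; 2nd port: Bergh–Rydh = WildQuotients.TameQuotientResolution
15644) · census T-web-tame (tame class may be EMPTY on the small-p wild bed). Integral projective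
X/k̄, dim ≤ 4, with a TAME web (all closed-point stabilisers on Y₂ of order prime to p) has a weak
resolution. -/
@[route_item "route-ResolutionOfSingularities-Dominance"]
def TameWebResolve : Prop :=
  ∀ p : ℕ, p.Prime → ∀ (k : Type) [Field k] [IsAlgClosed k] [CharP k p] (n : ℕ) (X : AlgebraicGeometry.Scheme.{0}) (ι : X ⟶ (Literature.AlgebraicGeometry.Motives.projectiveSpace n k).left), AlgebraicGeometry.IsClosedImmersion ι → AlgebraicGeometry.IsIntegral X → topologicalKrullDim X ≤ 4 → Summit.ResolutionOfSingularities.ResolutionOfSingularities.Theorems.GaloisWebClasses.HasTameWeb k p X → Literature.AlgebraicGeometry.Resolution.Scheme.HasResolution X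

/-- item stmt-ResolutionOfSingularities-29546 · aside · rank 9 · open · by planner
sources: AbramovichJong1996, DeJong1996
[aside] [TAGS · aside (outside the cone of closes (hR : RegularRoofs) (hS : SandwichedResolve);
NAMED-RUNG RULE) · node GaloisWeb = lens-4 g6 (HOME/decomp-res-lens-4/g6/GaloisWeb.lean sha256
62269666e3f28ddf) · CRITIC row 41 06:08:04Z «CLEARED AS CHILD NODE with decided carving; writer
asides + kernels»; notions Theorems/GaloisWebClasses.lean p763987; kernels
Theorems/DominanceGaloisWeb.lean] piece W · declared RESIDUAL of the node · WEAKER(evidence: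
necessary from the target slice, kernel wild_of_target) · critic: «W located residual score 0,
predicted ≡ S₄ on small-p bed (T-web-tame)» · leaf IDEA-NEEDED, LOCATED: the object is the quotient
model X₁ = X₂/G of a semi-stable curve family over the WILDLY ramified normalisation Y₂ of a regular
snc threefold pair (Lorenzini's wild quotient models of curves with a 3-dimensional base) for a
fourfold admitting NO tame web — exactly AdJ 1997 §1.3.2's obstruction. Split beneath (implication
only): WildWebReduction (E → S → WQ4 → W). Integral projective X/k̄, dim ≤ 4, with a web but no tame
web has a weak resolution. -/
@[route_item "route-ResolutionOfSingularities-Dominance"]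
def WildWebResolve : Prop :=
  ∀ p : ℕ, p.Prime → ∀ (k : Type) [Field k] [IsAlgClosed k] [CharP k p] (n : ℕ) (X : AlgebraicGeometry.Scheme.{0}) (ι : X ⟶ (Literature.AlgebraicGeometry.Motives.projectiveSpace n k).left), AlgebraicGeometry.IsClosedImmersion ι → AlgebraicGeometry.IsIntegral X → topologicalKrullDim X ≤ 4 → ¬ Summit.ResolutionOfSingularities.ResolutionOfSingularities.Theorems.GaloisWebClasses.HasTameWeb k p X → Summit.ResolutionOfSingularities.ResolutionOfSingularities.Theorems.GaloisWebClasses.HasWeb k X → Literature.AlgebraicGeometry.Resolution.Scheme.HasResolution X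

/-- item stmt-ResolutionOfSingularities-29547 · aside · rank 9 · open · by planner
sources: CossartPiltant2019, CossartJannsenSaito2020
[aside] [TAGS · aside (outside the cone of closes (hR : RegularRoofs) (hS : SandwichedResolve);
NAMED-RUNG RULE) · node GaloisWeb = lens-4 g6 (HOME/decomp-res-lens-4/g6/GaloisWeb.lean sha256
62269666e3f28ddf) · CRITIC row 41 06:08:04Z «CLEARED AS CHILD NODE with decided carving; writer
asides + kernels»; notions Theorems/GaloisWebClasses.lean p763987; kernels
Theorems/DominanceGaloisWeb.lean] piece E (layer 2) · UNDECIDED(census test T-eqres3: literature; G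
= 1 is CP2019 + CJS2020, every finite G in dim ≤ 2 is CJS2020 Thm. 6.6/6.9 (functorial ⇒
equivariant); dim 3 with G ≠ 1 NOT found in print; CP2019's LU + patching is non-canonical) · FLAG
«dim-3, not summit-implied» (equivariance is extra structure; not a consequence of S) · leaf
ATTACKABLE (dim-3 statement; the web uses only Y₂/G = Y regular snc, Y₂ = Nor(Y, L) — true for TAME
L by Abhyankar + toric resolution). For k = k̄ of char p, an integral projective Y₂ of dim ≤ 3 with
an action of a finite group G over k and a G-stable closed B ≠ Y₂ admits a G-equivariant projective
modification ψ : Y₃ → Y₂ with Y₃ regular integral projective and ψ⁻¹B a strict normal crossings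
divisor. -/
@[route_item "route-ResolutionOfSingularities-Dominance"]
def EquivariantLogResolutionThree : Prop :=
  ∀ p : ℕ, p.Prime → ∀ (k : Type) [Field k] [IsAlgClosed k] [CharP k p] (Y₂ : AlgebraicGeometry.Scheme.{0}) (h : Y₂ ⟶ AlgebraicGeometry.Spec (CommRingCat.of k)) (G : Type) [Group G] [Finite G] (ρ : G →* CategoryTheory.Aut Y₂) (B : Set Y₂), AlgebraicGeometry.IsIntegral Y₂ → Literature.AlgebraicGeometry.Motives.IsProjectiveOver (CategoryTheory.Over.mk h) → topologicalKrullDim Y₂ ≤ 3 → (∀ σ : G, CategoryTheory.CategoryStruct.comp (ρ σ).hom h = h) → IsClosed B → B ≠ Set.univ → (∀ (σ : G) (y : Y₂), y ∈ B → (ρ σ).hom.base y ∈ B) → ∃ (Y₃ : AlgebraicGeometry.Scheme.{0}) (ψ : Y₃ ⟶ Y₂) (ρ₃ : G →* CategoryTheory.Aut Y₃), AlgebraicGeometry.IsProper ψ ∧ Literature.AlgebraicGeometry.Resolution.IsBirational ψ ∧ (∀ σ : G, CategoryTheory.CategoryStruct.comp (ρ₃ σ).hom ψ = CategoryTheory.CategoryStruct.comp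 ψ (ρ σ).hom) ∧ Literature.AlgebraicGeometry.Resolution.Scheme.IsRegular Y₃ ∧ AlgebraicGeometry.IsIntegral Y₃ ∧ Literature.AlgebraicGeometry.Motives.IsProjectiveOver (CategoryTheory.Over.mk (CategoryTheory.CategoryStruct.comp ψ h)) ∧ Literature.AlgebraicGeometry.Resolution.IsStrictNormalCrossingsDivisor Y₃ (ψ.base ⁻¹' B)

/-- item stmt-ResolutionOfSingularities-29548 · aside · rank 9 · open · by planner
sources: DeJong1996, Kato1994, AbramovichJong1996
[aside] [TAGS · aside (outside the cone of closes (hR : RegularRoofs) (hS : SandwichedResolve);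
NAMED-RUNG RULE) · node GaloisWeb = lens-4 g6 (HOME/decomp-res-lens-4/g6/GaloisWeb.lean sha256
62269666e3f28ddf) · CRITIC row 41 06:08:04Z «CLEARED AS CHILD NODE with decided carving; writer
asides + kernels»; notions Theorems/GaloisWebClasses.lean p763987; kernels
Theorems/DominanceGaloisWeb.lean] piece S (layer 2) · KNOWN-MOD-PORT (engine: de Jong 1996
3.5/4.23–4.24 — X₃ toroidal for f₃⁻¹D₃; AdJ 1997 §2.4 separating branches/torific ideal; more simply
KKMS canonical barycentric subdivision is Aut-equivariant, so the toroidal resolution is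
G-equivariant; tree PROVED non-equivariant statement Kato1994_logRegularScheme_hasResolution_holds)
· UNDECIDED(necessity from S unknown: equivariance) · leaf INSTRUMENTABLE (port M–L). A G-semistable
pair over k̄ — f₃ : X₃ → Y₃ a G-equivariant semi-stable curve over a regular projective Y₃ with
G-stable snc divisor D₃, smooth off D₃, X₃ integral projective, G acting over k — admits a
G-equivariant proper birational ψ : X' → X₃ with X' regular integral projective. -/
@[route_item "route-ResolutionOfSingularities-Dominance"]
def EquivariantSemiStableResolution : Prop :=
  ∀ p : ℕ, p.Prime → ∀ (k : Type) [Field k] [IsAlgClosed k] [CharP k p] (X₃ Y₃ : AlgebraicGeometry.Scheme.{0}) (f₃ : X₃ ⟶ Y₃) (g₃ : Y₃ ⟶ AlgebraicGeometry.Spec (CommRingCat.of k)) (D₃ : Set Y₃) (G : Type) [Group G] [Finite G] (σX : G →* CategoryTheory.Aut X₃) (σY : G →* CategoryTheory.Aut Y₃) (hD : Literature.AlgebraicGeometry.Resolution.IsStrictNormalCrossingsDivisor Y₃ D₃), AlgebraicGeometry.IsIntegral X₃ → AlgebraicGeometry.IsIntegral Y₃ → Literature.AlgebraicGeometry.Motives.IsProjectiveOver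 (CategoryTheory.Over.mk (CategoryTheory.CategoryStruct.comp f₃ g₃)) → Literature.AlgebraicGeometry.Motives.IsProjectiveOver (CategoryTheory.Over.mk g₃) → Literature.AlgebraicGeometry.Resolution.Scheme.IsRegular Y₃ → Literature.AlgebraicGeometry.Resolution.IsSemiStableCurve f₃ → AlgebraicGeometry.Smooth (AlgebraicGeometry.morphismRestrict f₃ ⟨D₃ᶜ, hD.isClosed.isOpen_compl⟩) → (∀ σ : G, CategoryTheory.CategoryStruct.comp (σX σ).hom f₃ = CategoryTheory.CategoryStruct.comp f₃ (σY σ).hom) → (∀ σ : G, CategoryTheory.CategoryStruct.comp (σY σ).hom g₃ = g₃) → (∀ (σ : G) (y : Y₃), y ∈ D₃ → (σY σ).hom.base y ∈ D₃) → ∃ (X' : AlgebraicGeometry.Scheme.{0}) (ψ : X' ⟶ X₃) (σ' : G →* CategoryTheory.Aut X'), AlgebraicGeometry.IsProper ψ ∧ Literature.AlgebraicGeometry.Resolution.IsBirational ψ ∧ (∀ σ : G, CategoryTheory.CategoryStruct.comp (σ' σ).hom ψ = CategoryTheory.CategoryStruct.comp ψ (σX σ).hom) ∧ Literature.AlgebraicGeometry.Resolution.Scheme.IsRegular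 X' ∧ AlgebraicGeometry.IsIntegral X' ∧ Literature.AlgebraicGeometry.Motives.IsProjectiveOver (CategoryTheory.Over.mk (CategoryTheory.CategoryStruct.comp ψ (CategoryTheory.CategoryStruct.comp f₃ g₃)))

/-- item stmt-ResolutionOfSingularities-29549 · aside · rank 9 · open · by planner
sources: AbramovichJong1996, SGA1
[aside] [TAGS · aside (outside the cone of closes (hR : RegularRoofs) (hS : SandwichedResolve);
NAMED-RUNG RULE) · node GaloisWeb = lens-4 g6 (HOME/decomp-res-lens-4/g6/GaloisWeb.lean sha256
62269666e3f28ddf) · CRITIC row 41 06:08:04Z «CLEARED AS CHILD NODE with decided carving; writer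
asides + kernels»; notions Theorems/GaloisWebClasses.lean p763987; kernels
Theorems/DominanceGaloisWeb.lean] piece WQ4 (layer 2) · WEAKER(evidence: necessary from the target
slice, kernel wq4_of_target) · CONVERGENCE: = the F1 crux WildQuotients.WildQuotientResolution
(stmt-15640) ∩ {k algebraically closed, dim X₁ ≤ 4}, kernel wq4_of_wildQuotientResolution BY NAME
(dedup: no dim-4 k̄ slice of 15640 exists by name — lean search 2026-08-30; its order-p
perfect-field sibling is WildQuotients.CyclicQuotientFourfolds stmt-17941) · leaf BARRIER-adjacent /
IDEA-NEEDED (F1 blocker #1: Ellingsrud–Skjelbred / Lorenzini wild quotient singularities, non-CM).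
Quotients X₁ = X'/G of REGULAR integral fourfolds X' over k̄ by finite groups (q finite surjective
G-invariant with orbit fibres, étale over a dense open) have weak resolutions. -/
@[route_item "route-ResolutionOfSingularities-Dominance"]
def WildQuotientResolutionFourClosed : Prop :=
  ∀ p : ℕ, p.Prime → ∀ (k : Type) [Field k] [IsAlgClosed k] [CharP k p] (X' X₁ : AlgebraicGeometry.Scheme.{0}) (f : X₁ ⟶ AlgebraicGeometry.Spec (CommRingCat.of k)) (q : X' ⟶ X₁) (G : Type) [Group G] [Finite G] (ρ : G →* CategoryTheory.Aut X'), AlgebraicGeometry.IsSeparated f → AlgebraicGeometry.LocallyOfFiniteType f → AlgebraicGeometry.QuasiCompact f → AlgebraicGeometry.IsIntegral X₁ → AlgebraicGeometry.IsIntegral X' → Literature.AlgebraicGeometry.Resolution.Scheme.IsRegular X' → AlgebraicGeometry.IsFinite q → Function.Surjective q.base → (∃ U : X₁.Opens, Dense (U : Set X₁) ∧ AlgebraicGeometry.Etale (AlgebraicGeometry.morphismRestrict q U)) → (∀ σ : G, CategoryTheory.CategoryStruct.comp (ρ σ).hom q = q) → (∀ x y : X', q.base x = q.base y → ∃ σ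 : G, (ρ σ).hom.base x = y) → topologicalKrullDim X₁ ≤ 4 → Literature.AlgebraicGeometry.Resolution.Scheme.HasResolution X₁

/-- item stmt-ResolutionOfSingularities-29550 · aside · rank 9 · open · by planner
sources: SGA1, DeJong1996, EGAIV2
[aside] [TAGS · aside (outside the cone of closes (hR : RegularRoofs) (hS : SandwichedResolve);
NAMED-RUNG RULE) · node GaloisWeb = lens-4 g6 (HOME/decomp-res-lens-4/g6/GaloisWeb.lean sha256
62269666e3f28ddf) · CRITIC row 41 06:08:04Z «CLEARED AS CHILD NODE with decided carving; writer
asides + kernels»; notions Theorems/GaloisWebClasses.lean p763987; kernels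
Theorems/DominanceGaloisWeb.lean] piece R (layer-2 glue) · KNOWN-MOD-PORT implication E → S → WQ4 →
W (kernel wild_of_layer2 definitional; closes₂ = closes ∘ R) · leaf INSTRUMENTABLE (port M: E
applied to (Y₂, π⁻¹D) gives a G-equivariant regular snc Y₃; X₃ := X₂ ×_{Y₂} Y₃ is a G-semistable
pair — base change of a semi-stable curve, de Jong 2.22, integral by EGA IV 11.3.13, projective; S
gives a regular projective X' with G-action, X'/G exists (SGA1 V.1.8, fibres = orbits, generically
étale since G is faithful on K(X') = K(X₂)), X'/G → X₁ → X proper birational (K(X')^G = K(X₁)); WQ4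
resolves X'/G and Scheme.HasResolution.of_isBirational transports). Stated over the sibling asides
BY NAME. -/
@[route_item "route-ResolutionOfSingularities-Dominance"]
def WildWebReduction : Prop :=
  EquivariantLogResolutionThree → EquivariantSemiStableResolution → WildQuotientResolutionFourClosed → WildWebResolve

/-- item stmt-ResolutionOfSingularities-29715 · aside · rank 9 · open · by planner
sources: Kollar2007, CossartJannsenSaito2020, CossartPiltant2019
[aside] [TAGS · aside (outside the cone of closes hR hS; NAMED-RUNG RULE) · node DivisorCut = lens-3
g6 (HOME/decomp-res-lens-3/g6/DivisorCut.lean sha256 9d24df0e1bf5399f; rc 0 · 0 sorry) · CRITIC row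
39 «CLEARED AS ATTACK NODE on 24574»; kernels Theorems/DominanceDivisorCut*.lean; refines
Dominance:24574] piece LogResDiv · crux of the node · UNDECIDED — FLAG «sufficient rung, necessity
from S unknown» (at least summit-strength only via the kernels below, not known to follow from S;
OPEN from dim 4 in char p, KNOWN dim ≤ 3 (CossartJannsenSaito2020 Thm. 1.4 + CossartPiltant2019
Prop. 4.4)). Log resolution of divisors on regular varieties, blow-up format: Y regular integral
variety over a field of char p, D₁…Dₙ effective Cartier ⇒ ONE blowing up π : Y' → Y cosupported in ⋃
Supp Dᵢ with Y' regular and π⁻¹(⋃ Supp Dᵢ) snc. Split beneath: LogResDiv ⟸ EmbDesingDiv ∧ EndGameDiv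
(kernel logResDiv_of_embDesing_endGame PROVED). Why it might fail: it cannot fail below S only if S
⇒ LogResDiv, which is NOT known (log version stronger than plain resolution in char p); as a
statement it is Hironaka-strength in all dimensions. [Kollar2007 Thm. 3.35 (char 0);
CossartJannsenSaito2020 Thm. 1.4] -/
@[route_item "route-ResolutionOfSingularities-Dominance"]
def LogResDiv : Prop :=
  ∀ (p : ℕ), p.Prime → ∀ (k : Type) [Field k] [CharP k p] (Y : AlgebraicGeometry.Scheme.{0}) (g : Y ⟶ AlgebraicGeometry.Spec (CommRingCat.of k)), AlgebraicGeometry.IsSeparated g → AlgebraicGeometry.LocallyOfFiniteType g → AlgebraicGeometry.QuasiCompact g → AlgebraicGeometry.IsIntegral Y → Literature.AlgebraicGeometry.Resolution.Scheme.IsRegular Y → ∀ (n : ℕ) (D : Fin n → Y.IdealSheafData), (∀ i, Literature.AlgebraicGeometry.Resolution.IsEffectiveCartier (D i)) → ∃ (Q : Y.IdealSheafData) (Y' : AlgebraicGeometry.Scheme.{0}) (π : Y' ⟶ Y), (Q.support : Set Y) ⊆ (⋃ i, ((D i).support : Set Y)) ∧ Literature.AlgebraicGeometry.Resolution.IsBlowup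 π Q ∧ Literature.AlgebraicGeometry.Resolution.Scheme.IsRegular Y' ∧ Literature.AlgebraicGeometry.Resolution.IsStrictNormalCrossingsDivisor Y' (π ⁻¹' ⋃ i, ((D i).support : Set Y))

/-- item stmt-ResolutionOfSingularities-29716 · aside · rank 9 · open · by planner
sources: Kollar2007, Cutkosky2009
[aside] [TAGS · aside (outside the cone of closes hR hS; NAMED-RUNG RULE) · node DivisorCut = lens-3
g6 (HOME/decomp-res-lens-3/g6/DivisorCut.lean sha256 9d24df0e1bf5399f; rc 0 · 0 sorry) · CRITIC row
39 «CLEARED AS ATTACK NODE on 24574»; kernels Theorems/DominanceDivisorCut*.lean; refines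
Dominance:24574] piece MonomialPrincipalization · support · KNOWN-MOD-PORT (Goward 2005 Thm. 2 with
Lemma 1, any characteristic: an ideal generated by monomials in the components of an snc divisor on
a nonsingular variety is principalized by blow-ups in intersections of pairs of boundary components;
Cutkosky 2004 Lemma 3.11; Kollar2007 (3.16); port = nonsingular variety ↦ regular variety over any
field, regular-centre sequence ↦ one blow-up via Temkin 2008 Lemma 2.1.4; port size M). On a regular
integral variety Y, a non-zero finite sup ⨆ Dᵢ of effective Cartier ideals whose supports form one
snc divisor becomes effective Cartier after ONE blowing up cosupported in ⋃ Supp Dᵢ with regular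
source. [Kollar2007 (3.16); Cutkosky2009] -/
@[route_item "route-ResolutionOfSingularities-Dominance"]
def MonomialPrincipalization : Prop :=
  ∀ (p : ℕ), p.Prime → ∀ (k : Type) [Field k] [CharP k p] (Y : AlgebraicGeometry.Scheme.{0}) (g : Y ⟶ AlgebraicGeometry.Spec (CommRingCat.of k)), AlgebraicGeometry.IsSeparated g → AlgebraicGeometry.LocallyOfFiniteType g → AlgebraicGeometry.QuasiCompact g → AlgebraicGeometry.IsIntegral Y → Literature.AlgebraicGeometry.Resolution.Scheme.IsRegular Y → ∀ (n : ℕ) (D : Fin n → Y.IdealSheafData), (∀ i, Literature.AlgebraicGeometry.Resolution.IsEffectiveCartier (D i)) → (⨆ i, D i) ≠ ⊥ → Literature.AlgebraicGeometry.Resolution.IsStrictNormalCrossingsDivisor Y (⋃ i, ((D i).support : Set Y)) → ∃ (Q : Y.IdealSheafData) (Y' : AlgebraicGeometry.Scheme.{0}) (π : Y' ⟶ Y), (Q.support : Set Y) ⊆ (⋃ i, ((D i).support : Set Y)) ∧ Literature.AlgebraicGeometry.Resolution.IsBlowup π Q ∧ Literature.AlgebraicGeometry.Resolution.Scheme.IsRegular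 Y' ∧ Literature.AlgebraicGeometry.Resolution.IsEffectiveCartier ((⨆ i, D i).comap π)

/-- item stmt-ResolutionOfSingularities-29717 · aside · rank 9 · open · by planner
sources: SGA1, Hartshorne1977
[aside] [TAGS · aside (outside the cone of closes hR hS; NAMED-RUNG RULE) · node DivisorCut = lens-3
g6 (HOME/decomp-res-lens-3/g6/DivisorCut.lean sha256 9d24df0e1bf5399f; rc 0 · 0 sorry) · CRITIC row
39 «CLEARED AS ATTACK NODE on 24574»; kernels Theorems/DominanceDivisorCut*.lean; refines
Dominance:24574] piece IdealsAreSumsOfDivisors · support · COSTUME(textbook) — critic: «SGA6 II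
2.2.3 + 2.2.7.1 as a LITERATURE FACT rather than a Theses item»; filed here as an aside ONLY so the
kernels can name it, with a parallel `fact:` cite request (regular noetherian separated ⇒ divisorial
⇒ every non-zero ideal sheaf is a quotient of a finite sum of L^{−n}, images = invertible ideals
𝒪(−Z(s)); Brenner–Schröer 2003 Prop. 1.5). Every non-zero ideal sheaf on a regular variety is a
finite sup of effective Cartier ideals. When the Literature fact lands, provers cite it BY NAME and
this aside closes by `exact`. [SGA6 Exp. II 2.2.3, 2.2.7.1; Hartshorne1977 II Ex. 6.8 context] -/
@[route_item "route-ResolutionOfSingularities-Dominance"]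
def IdealsAreSumsOfDivisors : Prop :=
  ∀ (p : ℕ), p.Prime → ∀ (k : Type) [Field k] [CharP k p] (Y : AlgebraicGeometry.Scheme.{0}) (g : Y ⟶ AlgebraicGeometry.Spec (CommRingCat.of k)), AlgebraicGeometry.IsSeparated g → AlgebraicGeometry.LocallyOfFiniteType g → AlgebraicGeometry.QuasiCompact g → AlgebraicGeometry.IsIntegral Y → Literature.AlgebraicGeometry.Resolution.Scheme.IsRegular Y → ∀ I : Y.IdealSheafData, I ≠ ⊥ → ∃ (n : ℕ) (D : Fin n → Y.IdealSheafData), (∀ i, Literature.AlgebraicGeometry.Resolution.IsEffectiveCartier (D i)) ∧ (⨆ i, D i) = I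

/-- item stmt-ResolutionOfSingularities-29718 · aside · rank 9 · open · by planner
sources: Kollar2007
[aside] [TAGS · aside (outside the cone of closes hR hS; NAMED-RUNG RULE) · node DivisorCut = lens-3
g6 (HOME/decomp-res-lens-3/g6/DivisorCut.lean sha256 9d24df0e1bf5399f; rc 0 · 0 sorry) · CRITIC row
39 «CLEARED AS ATTACK NODE on 24574»; kernels Theorems/DominanceDivisorCut*.lean; refines
Dominance:24574] node WeakPrincipalization · glue · PROVED from IdealsAreSumsOfDivisors ∧
MonomialPrincipalization ∧ LogResDiv (kernel weakPrincipalization_of, ≈ 70 lines, 0 sorry) —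
Piltant's Axiom 4 in blow-up format (cf. Literature PrincipalizationInChar) WITHOUT the
admissibility clause V(Q) ⊆ V(I): the divisor route blows up along the generator divisor, not along
V(I), which is irrelevant for MR. Every non-zero ideal sheaf on a regular integral variety becomes
effective Cartier after ONE blowing up along a nowhere-dense centre with regular source. Consumer:
kernel sandwichedResolveProper_of_weakPrincipalization PROVED ⇒ 24574 SandwichedResolveProper.
[Kollar2007 Thm. 3.35; Piltant 2013 §2 Axiom 4 (no bib key)] -/
@[route_item "route-ResolutionOfSingularities-Dominance", crux]
def WeakPrincipalization : Prop :=
  ∀ (p : ℕ), p.Prime → ∀ (k : Type) [Field k] [CharP k p] (Y : AlgebraicGeometry.Scheme.{0}) (g : Y ⟶ AlgebraicGeometry.Spec (CommRingCat.of k)), AlgebraicGeometry.IsSeparated g → AlgebraicGeometry.LocallyOfFiniteType g → AlgebraicGeometry.QuasiCompact g → AlgebraicGeometry.IsIntegral Y → Literature.AlgebraicGeometry.Resolution.Scheme.IsRegular Y → ∀ I : Y.IdealSheafData, I ≠ ⊥ → ∃ (Q : Y.IdealSheafData) (Y' : AlgebraicGeometry.Scheme.{0}) (π : Y' ⟶ Y),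 (Q.support : Set Y) ≠ Set.univ ∧ Literature.AlgebraicGeometry.Resolution.IsBlowup π Q ∧ Literature.AlgebraicGeometry.Resolution.Scheme.IsRegular Y' ∧ Literature.AlgebraicGeometry.Resolution.IsEffectiveCartier (I.comap π)

/-- item stmt-ResolutionOfSingularities-29719 · aside · rank 9 · open · by planner
sources: DeJong1996
[aside] [TAGS · aside (outside the cone of closes hR hS; NAMED-RUNG RULE) · node DivisorCut = lens-3
g6 (HOME/decomp-res-lens-3/g6/DivisorCut.lean sha256 9d24df0e1bf5399f; rc 0 · 0 sorry) · CRITIC row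
39 «CLEARED AS ATTACK NODE on 24574»; kernels Theorems/DominanceDivisorCut*.lean; refines
Dominance:24574] piece ProperReduction · support · KNOWN-MOD-LIBRARY — SandwichedResolveProper
(24574) → SandwichedResolve (24572): Nagata compactification of the sandwich map b : Γ → Y (tree
named fact Literature NagataCompactification) + passage to an irreducible component + restriction of
resolutions to opens (the glue pattern of Theorems/DominanceOfTwoModelPatching.lean); kernel
properReduction_of_nagata (hN : NagataCompactification.{0}) : ProperReduction PROVED (≈ 140 lines).
This is the step that puts 24574 INTO the cone of closes: closes hR (properReduction
(sandwichedResolveProper_of …)). [DeJong1996 §4 context; Conrad 2007 Thm. 4.1 / Stacks 0F41 (no bib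
keys)] -/
@[route_item "route-ResolutionOfSingularities-Dominance"]
def ProperReduction : Prop :=
  SandwichedResolveProper → SandwichedResolve

/-- item stmt-ResolutionOfSingularities-29720 · aside · rank 9 · open · by planner
sources: CossartJannsenSaito2020, CossartPiltant2019
[aside] [TAGS · aside (outside the cone of closes hR hS; NAMED-RUNG RULE) · node DivisorCut = lens-3
g6 (HOME/decomp-res-lens-3/g6/DivisorCut.lean sha256 9d24df0e1bf5399f; rc 0 · 0 sorry) · CRITIC row
39 «CLEARED AS ATTACK NODE on 24574»; kernels Theorems/DominanceDivisorCut*.lean; refines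
Dominance:24574] piece EmbDesingDiv · crux beneath LogResDiv · UNDECIDED — FLAG «sufficient rung,
necessity from S unknown» · the LOCATED CORE in dimension 4 (embedded desingularization of reduced
threefolds in regular fourfolds; printed partial: Cossart–Piltant 2008/2009 embedded LU of h^p −
g^{p−1}h + f = 0; TAME sub-piece (multiplicities < p) = the cell's seam 27136/28008 by maximal
contact; WILD sub-piece IDEA-NEEDED). CJS end-format without transversality: D₁…Dₙ effective Cartier
on a regular integral variety Y ⇒ ONE blowing up π cosupported in ⋃ Supp Dᵢ, Y' regular, π⁻¹(⋃ Supp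
Dᵢ) = Supp X ∪ B with X effective Cartier with regular subscheme (strict transform) and B snc
(exceptional). Why it might fail: Hironaka-strength in all dimensions; in dim 4 it is exactly the
open embedded-threefold problem. [CossartJannsenSaito2020 Thm. 1.4 (dim Y ≤ 3); CossartPiltant2019
§4] -/
@[route_item "route-ResolutionOfSingularities-Dominance", crux]
def EmbDesingDiv : Prop :=
  ∀ (p : ℕ), p.Prime → ∀ (k : Type) [Field k] [CharP k p] (Y : AlgebraicGeometry.Scheme.{0}) (g : Y ⟶ AlgebraicGeometry.Spec (CommRingCat.of k)), AlgebraicGeometry.IsSeparated g → AlgebraicGeometry.LocallyOfFiniteType g → AlgebraicGeometry.QuasiCompact g → AlgebraicGeometry.IsIntegral Y → Literature.AlgebraicGeometry.Resolution.Scheme.IsRegular Y → ∀ (n : ℕ) (D : Fin n → Y.IdealSheafData), (∀ i, Literature.AlgebraicGeometry.Resolution.IsEffectiveCartier (D i)) → ∃ (Q : Y.IdealSheafData) (Y' : AlgebraicGeometry.Scheme.{0}) (π : Y' ⟶ Y) (X : Y'.IdealSheafData) (B : Set Y'), (Q.support : Set Y) ⊆ (⋃ i, ((D i).support : Set Y))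 ∧ Literature.AlgebraicGeometry.Resolution.IsBlowup π Q ∧ Literature.AlgebraicGeometry.Resolution.Scheme.IsRegular Y' ∧ Literature.AlgebraicGeometry.Resolution.IsEffectiveCartier X ∧ Literature.AlgebraicGeometry.Resolution.Scheme.IsRegular X.subscheme ∧ Literature.AlgebraicGeometry.Resolution.IsStrictNormalCrossingsDivisor Y' B ∧ (π ⁻¹' ⋃ i, ((D i).support : Set Y)) = (X.support : Set Y') ∪ B

/-- item stmt-ResolutionOfSingularities-29721 · aside · rank 9 · open · by planner
sources: Kollar2007, CossartJannsenSaito2020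
[aside] [TAGS · aside (outside the cone of closes hR hS; NAMED-RUNG RULE) · node DivisorCut = lens-3
g6 (HOME/decomp-res-lens-3/g6/DivisorCut.lean sha256 9d24df0e1bf5399f; rc 0 · 0 sorry) · CRITIC row
39 «CLEARED AS ATTACK NODE on 24574»; kernels Theorems/DominanceDivisorCut*.lean; refines
Dominance:24574] piece EndGameDiv · support beneath LogResDiv · ATTACKABLE in dimension 4 (closed
modulo {CossartJannsenSaito2020Embedded fact, CossartPiltant2019 Prop. 4.4 pattern
embeddedSncThreefolds_of, MonomialPrincipalization, E-chain (E1)–(E5) critic-CHECKED} = PROVER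
TARGET #4 of the cell), UNDECIDED as an all-dimensions statement (in substance LogResDiv ONE
DIMENSION DOWN: X is formally a graph over a boundary component B₁; separate X from B by log
resolution of X|_{B₁} + B'|_{B₁} inside B₁, then Goward principalization of (y₁, M)) ·
WEAKER(evidence: dimension shift — every component already regular). End game: X effective Cartier
with regular subscheme and B snc on a regular integral variety Y ⇒ ONE blowing up cosupported in
Supp X ∩ B with regular source on which the preimage of Supp X ∪ B is snc. Census ask T-endgame
(desk). [Kollar2007 Thm. 3.35 (char 0); CossartJannsenSaito2020 Thm. -/
@[route_item "route-ResolutionOfSingularities-Dominance", crux]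
def EndGameDiv : Prop :=
  ∀ (p : ℕ), p.Prime → ∀ (k : Type) [Field k] [CharP k p] (Y : AlgebraicGeometry.Scheme.{0}) (g : Y ⟶ AlgebraicGeometry.Spec (CommRingCat.of k)), AlgebraicGeometry.IsSeparated g → AlgebraicGeometry.LocallyOfFiniteType g → AlgebraicGeometry.QuasiCompact g → AlgebraicGeometry.IsIntegral Y → Literature.AlgebraicGeometry.Resolution.Scheme.IsRegular Y → ∀ (X : Y.IdealSheafData) (B : Set Y), Literature.AlgebraicGeometry.Resolution.IsEffectiveCartier X → Literature.AlgebraicGeometry.Resolution.Scheme.IsRegular X.subscheme → Literature.AlgebraicGeometry.Resolution.IsStrictNormalCrossingsDivisor Y B → ∃ (Q : Y.IdealSheafData) (Y' : AlgebraicGeometry.Scheme.{0}) (π : Y' ⟶ Y), (Q.support : Set Y) ⊆ (X.support : Set Y) ∩ B ∧ Literature.AlgebraicGeometry.Resolution.IsBlowup π Q ∧ Literature.AlgebraicGeometry.Resolution.Scheme.IsRegular Y' ∧ Literature.AlgebraicGeometry.Resolution.IsStrictNormalCrossingsDivisor Y' (π ⁻¹' ((X.support : Set Y) ∪ B))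

/-- item stmt-ResolutionOfSingularities-30042 · aside · rank 9 · open · by planner
sources: Cutkosky2009, StacksProject
[aside · refines MR^{proper} = SandwichedResolveProper 24574 · EXACT by theorem
(Theorems/DominanceMaxOrderAtoms: blowupResolve_iff_item24574 via PROVED Raynaud–Gruson domination
exists_isBlowup_dominating; blowupResolve_iff_steps) · NECESSARY (blowupResolve_of_summit) ·
UNDECIDED = the cell's 24572/24574 booking · CRITIC-LEDGER row 46 (2026-08-30T07:24Z, lens-3 g7
MaxOrderAtoms @91036a4fcfe2fdc9): CLEARED AS MAP + PORT-SHARPENING NODE · writer: ASIDE (NAMED-RUNG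
RULE), no new route] BlowupResolve: over any field k of char p, for every regular integral separated
finite-type k-variety Y and every ideal sheaf I ≠ 0, every blow-up Γ = Bl_I Y → Y has a resolution
(tree HasResolution). All-ideal rung format of MR (Cutkosky2009 Thm. 1.3 ⟸ 5.1 ladder); census data
lens file sha256 91036a4fcfe2fdc9. -/
@[route_item "route-ResolutionOfSingularities-Dominance", crux]
def BlowupResolve : Prop :=
  ∀ p : ℕ, p.Prime → ∀ (k : Type) [Field k] [CharP k p] (Y : AlgebraicGeometry.Scheme.{0}) (g : Y ⟶ AlgebraicGeometry.Spec (.of k)), AlgebraicGeometry.IsSeparated g → AlgebraicGeometry.LocallyOfFiniteType g → AlgebraicGeometry.QuasiCompact g → AlgebraicGeometry.IsIntegral Y → Literature.AlgebraicGeometry.Resolution.Scheme.IsRegular Y → ∀ I : Y.IdealSheafData, I ≠ ⊥ → ∀ (Γ : AlgebraicGeometry.Scheme.{0}) (b : Γ ⟶ Y), Literature.AlgebraicGeometry.Resolution.IsBlowup b I → Literature.AlgebraicGeometry.Resolution.Scheme.HasResolution Γ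

/-- item stmt-ResolutionOfSingularities-30043 · aside · rank 9 · open · by planner
sources: Cutkosky2009, BierstoneGrigorievMilmanWlodarczyk2011
[aside · TAME ATOM ∀ r ≥ 1 (r < p): PR_all^{≤ r−1} ⟹ PR_all^{≤ r} for ideals of maximal order ≤ r
(notion Theorems.MaxOrderAtomClasses.MaxOrderStepTame, p764812) · NECESSARY
(maxOrderStepsTame_of_summit) · all-dim = glue modulo dimension d−1 above ⇒ UNDECIDED (critic row
46: «kernel not typed §6, std (a) ⇒ slice certifies only at the dim-4 rung»); dim-4 slice
MaxOrderStepTameDimFour r ATTACKABLE-mod-port by reference to 27136/28009 (+ all-ideal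
contact/bridge ports) · (A) graded VARIANT of OrderCut row 35 (order-vs-p cut in all-ideal rung
format) · CRITIC-LEDGER row 46 (2026-08-30T07:24Z, lens-3 g7 MaxOrderAtoms @91036a4fcfe2fdc9):
CLEARED AS MAP + PORT-SHARPENING NODE · writer: ASIDE] MaxOrderStepsTame: for every r ≥ 1 and every
prime p > r, over every field of char p: if blow-ups of all nonzero ideals of maximal order ≤ r−1 on
regular integral varieties resolve, then so do blow-ups of ideals of maximal order ≤ r (Cutkosky2009
Thm. 5.1 format, all ideals not pencils). -/
@[route_item "route-ResolutionOfSingularities-Dominance", crux]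
def MaxOrderStepsTame : Prop :=
  ∀ r : ℕ, 1 ≤ r → Summit.ResolutionOfSingularities.ResolutionOfSingularities.Theorems.MaxOrderAtomClasses.MaxOrderStepTame r

/-- item stmt-ResolutionOfSingularities-30044 · aside · rank 9 · open · by planner
sources: Cutkosky2009, Moh1987, Hauser2010
[aside · WILD ATOM ∀ r ≥ 1 (p ≤ r) · DECLARED RESIDUAL of the node · NECESSARY
(maxOrderStepsWild_of_summit) · WEAKER than S by letter only vacuously (p > r excluded) · ⊇
everything hard (wild maximal order: Moh/Hauser kangaroo phenomena) ⇒ IDEA-NEEDED, distribution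
score 0 (critic row 46) · VARIANT of OrderCut's order-vs-p cut (row 35) in all-ideal rung format;
PencilReduction costume replaced by the PROVED Raynaud–Gruson domination · EXACT jointly: 24574 ⟺
MaxOrderStepsTame ∧ MaxOrderStepsWild (item24574_iff_atoms) · CRITIC-LEDGER row 46
(2026-08-30T07:24Z, lens-3 g7 MaxOrderAtoms @91036a4fcfe2fdc9): CLEARED AS MAP + PORT-SHARPENING
NODE · writer: ASIDE (NAMED-RUNG RULE)] MaxOrderStepsWild: for every r ≥ 1 and every prime p ≤ r,
over every field of char p: PR_all^{≤ r−1} ⟹ PR_all^{≤ r} for blow-ups of ideals of maximal order ≤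
r on regular integral varieties (Barriers: Moh1987 / Hauser2010 wild jumps live exactly here). -/
@[route_item "route-ResolutionOfSingularities-Dominance", crux]
def MaxOrderStepsWild : Prop :=
  ∀ r : ℕ, 1 ≤ r → Summit.ResolutionOfSingularities.ResolutionOfSingularities.Theorems.MaxOrderAtomClasses.MaxOrderStepWild r

/-- item stmt-ResolutionOfSingularities-30045 · aside · rank 9 · open · by planner
sources: Cutkosky2009, CossartPiltant2019
[aside · FIRST OPEN SLICE (ambient dimension ≤ 4) of BlowupResolve · EXACT by theorem:
BlowupResolveDimFour ⟺ (∀ r ≥ 1, MaxOrderStepTameDimFour r) ∧ (∀ r ≥ 1, MaxOrderStepWildDimFour r)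
(blowupResolveDimFour_iff_atoms, Theorems/DominanceMaxOrderAtoms) · NECESSARY
(blowupResolveDimFour_of_summit) · sits exactly on the catalogued DimensionFourFrontier barrier
(CossartPiltant2019 dim 3 known; dim 4 open except k̄ hypersurface-order cases) ⇒ UNDECIDED; Tame₄
ATTACKABLE-mod-port, Wild₄ IDEA-NEEDED (located residual, maxOrderStepWildDimFour_of_summit) ·
CRITIC-LEDGER row 46 (2026-08-30T07:24Z, lens-3 g7 MaxOrderAtoms @91036a4fcfe2fdc9): CLEARED AS MAP
+ PORT-SHARPENING NODE · (C) placement of the lens NOT filed (critic: no credit) · writer: ASIDE]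
BlowupResolveDimFour: BlowupResolve restricted to topologicalKrullDim Y ≤ 4. -/
@[route_item "route-ResolutionOfSingularities-Dominance"]
def BlowupResolveDimFour : Prop :=
  ∀ p : ℕ, p.Prime → ∀ (k : Type) [Field k] [CharP k p] (Y : AlgebraicGeometry.Scheme.{0}) (g : Y ⟶ AlgebraicGeometry.Spec (.of k)), AlgebraicGeometry.IsSeparated g → AlgebraicGeometry.LocallyOfFiniteType g → AlgebraicGeometry.QuasiCompact g → AlgebraicGeometry.IsIntegral Y → Literature.AlgebraicGeometry.Resolution.Scheme.IsRegular Y → topologicalKrullDim Y ≤ 4 → ∀ I : Y.IdealSheafData, I ≠ ⊥ → ∀ (Γ : AlgebraicGeometry.Scheme.{0}) (b : Γ ⟶ Y), Literature.AlgebraicGeometry.Resolution.IsBlowup b I → Literature.AlgebraicGeometry.Resolution.Scheme.HasResolution Γ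

/-- item stmt-ResolutionOfSingularities-30325 · aside · rank 9 · open · by planner
sources: CossartJannsenSaito2020, Kato1994, CossartPiltant2019, Temkin2013
[aside · refines the portfolio blocker PAlteration.PicoverLocalModel 0557 · GRADE ≤ 3 of the SPLIT
CORANK c of the radicand class mod p-th powers (one integer, dimension-free: after formal Morse
splitting the complete local cover is a quadric bundle over a regular (c+1)-fold carrying ONE purely
inseparable hypersurface Tᵖ = G(w₁..w_c)) · NECESSARY (0557 ⟹ this, proved) · WEAKER by letter
(every catalogued pathology — Moh–Hauser kangaroo, Hauser–Perlega, CP 2019 Ex. 3.2 — has q = 0 i.e.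
grade c = n, outside LE 3 for n ≥ 4) · UNDECIDED ≡ WeakMarkedRadicandThree mod ports P1 (formal
splitting mod Frobenius) / P2 (quadric chart identity, VERIFIED by the critic) / P4 (gluing along
positive-dimensional critical strata) = the cell's convergence cell (dim-4 weak order reduction)
reached from the BLOCKER side, for all n at once · IDEA-NEEDED · barrier DimensionFourFrontier
conceded · why it might fail: the c = 3 rung is embedded resolution of Tᵖ = G(w₁,w₂,w₃) in a regular
fourfold, open (valuation-local form only: Cossart–Piltant 2008/2009) · lens-1 g7 CorankLadder
6d558789858ead62 · CRITIC row 48 CLEARED AS MAP NODE, child of 0557 (residual 0 · decision 0 · map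
+1) · writer: ASIDE hosted o -/
@[route_item "route-ResolutionOfSingularities-Dominance"]
def PicoverCorankLEThree : Prop :=
  Summit.ResolutionOfSingularities.ResolutionOfSingularities.Theorems.RadicandSplitCorank.PicoverLocalModelCorankLE 3

/-- item stmt-ResolutionOfSingularities-30326 · aside · rank 9 · open · by planner
sources: CossartJannsenSaito2020, Kato1994, CossartPiltant2019, Temkin2013
[aside · refines 0557 · RESIDUAL of grade > 3: radicands with some maximal ideal outside the grade-3
menu (split corank ≥ 4, or a quadratic part that does not split in O) · DECLARED RESIDUAL · COFINAL
(contains every radicand with one umbilic of corank ≥ 4) ⇒ NOT weaker, honest score 0 · UNDECIDED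
(test = absorption CorankGT 3 ⇒ 0557 via a specialisation principle or Zariski gluing of local-model
resolutions — the tree's located gap picover_iff_functorialLocalResolutions; neither available) ·
BARRIER/IDEA-NEEDED: this is Temkin's «purely inseparable case proper» (Temkin2013 §1.3) · EXACT:
0557 ⟺ PicoverCorankLEThree ∧ PicoverCorankGTThree (picoverLocalModel_iff_asides) · why it might
fail: it is the blocker minus a thin menu · lens-1 g7 CorankLadder 6d558789858ead62 · CRITIC row 48
CLEARED AS MAP NODE, child of 0557 (residual 0 · decision 0 · map +1) · writer: ASIDE hosted on
Dominance (0557's route pAlteration is another planner's; re-informal of 0557 owed); defs +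
parametrised pieces Theorems/RadicandSplitCorank (p765336), kernels BY NAME
Theorems/PicoverLocalModelCorankLadder (picoverLocalModel_iff EXACT ∀c, closes → 0557, root_of →
ROOT via Valuative.closes with 10968/0642)] Pi -/
@[route_item "route-ResolutionOfSingularities-Dominance"]
def PicoverCorankGTThree : Prop :=
  Summit.ResolutionOfSingularities.ResolutionOfSingularities.Theorems.RadicandSplitCorank.PicoverLocalModelCorankGT 3

/-- item stmt-ResolutionOfSingularities-30327 · aside · rank 9 · open · by planner
sources: CossartJannsenSaito2020, Kato1994, CossartPiltant2019, Temkin2013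
[aside · refines 0557 · GRADE ≤ 2 = the KNOWN RANGE for every n = dim R and every p ·
KNOWN-MOD-PORT(L): non-critical points regular (tree AdjoinRoot.isRegularLocalRing_X_pow_sub_C),
Kummer points log regular (tree isLogRegularLocal_of_kummerForm +
Kato1994_logRegular_hasResolution_general), tail c ≤ 2 = embedded resolution of the purely
inseparable SURFACE Tᵖ = G(w₁,w₂) in a regular threefold by CossartJannsenSaito2020 Thm. 1.4
(canonical, functorial) / Benito–Villamayor 2012 · ports P1 (M), P3 weakly admissible extraction for
marking 2 (M), P4 gluing/descent along positive-dimensional critical strata = the ONE real L-port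
(choice of splitting is the only non-canonical input); isolated-critical slice DECIDED-MOD-PORT(M)
via CRITIC row 43 §D (parafactorial 𝔪-primary descent) · rides along: PicoverCorankLEThree ⟹ this
(corankLETwo_of_three) · ATTACKABLE (port, size L) · why it might fail: only the gluing port P4 — a
non-canonical splitting choice along a critical curve could obstruct patching the local CJS
resolutions · lens-1 g7 CorankLadder 6d558789858ead62 · CRITIC row 48 CLEARED AS MAP NODE, child of
0557 (residual 0 · decision 0 · map +1) · writer: ASIDE hosted on Dominance (05 -/
@[route_item "route-ResolutionOfSingularities-Dominance"]
def PicoverCorankLETwo : Prop :=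
  Summit.ResolutionOfSingularities.ResolutionOfSingularities.Theorems.RadicandSplitCorank.PicoverLocalModelCorankLE 2

/-- item stmt-ResolutionOfSingularities-30328 · aside · rank 9 · open · by planner
sources: CossartJannsenSaito2020, Kato1994, CossartPiltant2019, Temkin2013
[aside · typed ATTACK LEAF of grade c = 3 over lens-2's landed vocabulary
(WeakOrderReduction.WeakResolution: weakly admissible centre sequence with empty final support) ·
WEAK RESOLUTION OF THE MARKED RADICAND IDEAL ((Tᵖ − g), 2) on Spec S[T], S a regular finitely
generated k-domain of dimension ≤ 3 — exactly what the quadric bundle over a split-corank-3 point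
consumes (chart identity P2) · not S-implied by letter (sequence form) · INSTRUMENTABLE
(Cossart–Piltant CP-II gives it valuation-locally; for p = 2 ord(T² − g) = 2 wherever critical, so
literally an instance of WeakOrderReduction.SeqDimFour 1 2 restricted to these ideals) · d ≤ 2 twin
KNOWN-MOD-PORT (CJS 2020 Thm. 1.4) · = the test of PicoverCorankLEThree; converges with lens-5
SHALLOW₄, lens-3 EmbDesingDiv₄, lens-2/4 E 1, 28913 RankOneRadicands · census: c = 3 umbilic
radicands = T-moh-3 stage C (low priority) · why it might fail: it is global weak order reduction in
dimension 4 for a hypersurface of order p — the DimensionFourFrontier barrier sits exactly here ·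
lens-1 g7 CorankLadder 6d558789858ead62 · CRITIC row 48 CLEARED AS MAP NODE, child of 0557 (residual
0 · decision 0 · map +1) · writer: ASIDE hosted on Dominance -/
@[route_item "route-ResolutionOfSingularities-Dominance"]
def WeakMarkedRadicandThree : Prop :=
  Summit.ResolutionOfSingularities.ResolutionOfSingularities.Theorems.RadicandSplitCorank.WeakMarkedRadicand 3

/-- item stmt-ResolutionOfSingularities-24579 · assembly · rank 1 · open · by planner
sources: Cutkosky2009
[assembly] RegularRoofs → SandwichedResolve → ResolutionOfSingularities. -/
@[route_item "route-ResolutionOfSingularities-Dominance"]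
def Assembly : Prop :=
  RegularRoofs → SandwichedResolve → _root_.ResolutionOfSingularities

/-! D-0027 §2.1 — DECIDING THEOREM (planner-authored via `route open/edit --closes-file`; by planner-decomp-res-lens-4-g0-0 2026-08-30T01:52:17Z):
its hypotheses are this route's items and its conclusion the sub-problem Statement (glue_lint), and it elaborates with this file. -/

@[closes "route-ResolutionOfSingularities-Dominance"] theorem closes (hR : RegularRoofs) (hS : SandwichedResolve) : _root_.ResolutionOfSingularities := by
  refine _root_.ResolutionOfSingularities_iff.mpr fun p hp => ?_
  rw [Literature.AlgebraicGeometry.Resolution.ComponentGluing.resolutionInChar_iff_integral]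
  intro k _ _ X f hsep hft hqc hint
  obtain ⟨Γ, Y, a, b, g, hg1, hg2, hg3, hY, hΓ, ha, hab, hb1, hb2, hb3, hbb⟩ :=
    hR p hp k X f hsep hft hqc hint
  haveI := ha
  exact Literature.AlgebraicGeometry.Resolution.ComponentGluing.Scheme.HasResolution.of_isBirational a hab
    (hS p hp k Y g hg1 hg2 hg3 hY Γ b hb1 hb2 hb3 hbb hΓ)

end Summit.ResolutionOfSingularities.ResolutionOfSingularities.Theses.Dominance
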